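import Literature.NumberTheory.NumberFields.NonGaloisQuarticCMFieldClassNumber
import HarnessLib

/-!
# Ideal classes of the explicit primes of the non-Galois quartic CM field `ℚ(√−(3+√2))`, II:
# above `47` (the second totally split prime), `71`, `137` (four principal primes), `193` (four non-principal ones),
# `73`, and the degree-two primes above `19`, `59` (non-principal) and `29`, `37`, `53` (principal)
# (Marcus, *Number Fields*, Ch. 3 Thm 27 and Ch. 5, discussion after Thm 37)

[cite: Marcus2018, Ch. 3 Thm 27 (primes `(p, g_i(α))`), Ch. 5 Cor. 2 of Thm 35 and the discussion after Thm 37 (class-group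
computations by norms of elements)]

Own-lane stem of `lit-deligne-2` continuing `NonGaloisQuarticCMFieldClassNumber` §16–§19 (that file is at the gate's size limit):
`K = KD = ℚ(√−(3+√2))`, `𝓞_K = ℤ[a]`, `a² = −(3 + √2)`, `Cl_K = {1, [𝔓₂]}` with `𝔓₂ = (2, a − 1)`, `𝔓₂² = (√2) = (a² + 3)`.
For a prime `P` the dichotomy "`P` principal / `P ∈ [𝔓₂]`" is decided by exhibiting an element `x ∈ P` of norm `‖P‖`
(then `P = (x)`) or an element `x ∈ P ∩ 𝔓₂` of norm `2‖P‖` (then `(x) = 𝔓₂·P`, and `P` principal would force `𝔓₂` principal,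
contradicting `not_isPrincipal_w₂`).  Norms of elements are computed inside `𝓞_K` from `x·x̄` and the Dedekind–Kummer
factorisations of `NonGaloisQuarticCMFieldPrimeDecomposition` by the bookkeeping lemma `eq_and_eq_of_le_of_absNorm'`
(`Y ≤ A`, `Z ≤ B`, `‖Y‖‖Z‖ = ‖A‖‖B‖ ⟹ Y = A ∧ Z = B`).

* §0 in-file copies of the elementary helpers of `NonGaloisQuarticCMFieldClassNumber` (`a⁴ + 6a² + 7 = 0`, `ā = −a`,
  `‖(x̄)‖ = ‖(x)‖`, `‖(n)‖ = n⁴`, `(a² + 3) = 𝔓₂²`, the bookkeeping lemma, `I·J = (g) ⟹ (I principal ⟺ J principal)`);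
* §1 **above `47`** (`r = 7`, `2² ≡ r − 3`, `15² ≡ −(r + 3)`): `47𝓞_K = (47, a − 2)(47, a + 2)(47, a − 15)(47, a + 15)`,
  `(a² − 4) = (47, a − 2)(47, a + 2)`, `(a² + 10) = (47, a − 15)(47, a + 15)`, **`(47, a ∓ 2) = (a ∓ 2)` principal**
  (`span_fortySeven_sub_two_eq`); `(5a² + 3) = 𝔓₂²(47, a − 15)(47, a + 15)` (`5a² + 3 = −(a² + 2)(a² + 3)(a² + 10)`, the cofactor
  `−(a² + 2) = 1 + √2` a unit), `(2a² + a + 5) = 𝔓₂·(47, a − 15)` (norm `94`), so **`(47, a ∓ 15)` are NOT principal**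
  (`not_isPrincipal_span_fortySeven`): as above `31`, both classes occur twice;
* §1 **above `71`** (`r = 12`, `3² ≡ r − 3`, `−(r + 3)` a non-residue): `71𝓞_K = (71, a − 3)(71, a + 3)(71, a² + 15)`,
  `(a² − 9) = 𝔓₂²(71, a − 3)(71, a + 3)` (`a² − 9 = (a² + 3)(−6a² − 17)`, `−6a² − 17 = −71 − 6(a² − 9)`),
  `(a² + 15) = 𝔓₂²(71, a² + 15)`, `(a ∓ 3) = 𝔓₂·(71, a ∓ 3)` (`‖(a ∓ 3)‖ = 142`: `X⁴ + 6X² + 7` takes the value `142` at `±3`),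
  so **`(71, a ∓ 3)` are NOT principal** (`span_seventyOne_factors`, `not_isPrincipal_span_seventyOne`).

* §2 **`137`, the smallest prime splitting completely into four PRINCIPAL primes** (`r = 106`, `68² ≡ r − 3`, `24² ≡ −(r + 3)`):
  `(4a² − 1) = (137, a − 68)(137, a + 68)`, `(4a² + 25) = (137, a − 24)(137, a + 24)`, **`(137, a ∓ 68) = (2a ± 1)`,
  `(137, a ∓ 24) = (a³ ± a² + 5a ± 2)`** (`span_oneThirtySeven_eq`);
* §3 **`193`, a prime splitting completely into four NON-principal primes** (`r = 141`, `36² ≡ r − 3`, `7² ≡ −(r + 3)`):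
  `(7a² + 43) = 𝔓₂²(193, a − 7)(193, a + 7)`, `(1 − 7a²) = 𝔓₂²(193, a − 36)(193, a + 36)`, `(a³ + 6a + 1) = 𝔓₂·(193, a − 7)`,
  `(3a² − a + 8) = 𝔓₂·(193, a − 36)` (norms `386`), so **all four primes above `193` lie in `[𝔓₂]`**
  (`span_oneNinetyThree_factors`, `not_isPrincipal_span_oneNinetyThree`);
* §4 **degree-two primes (shape `𝔓𝔓′`, `p ≡ ±3 (mod 8)`)**: `(a² + 1) = 𝔓₂²` (private `span_sq_add_one_eq`);
  `(2a³ + a² + 5a + 4) = 𝔓₂·(19, a² − 4a + 11)`, `(2a³ − a² + 5a − 4) = 𝔓₂·(19, a² + 4a + 11)` (norms `722`), so **neither prime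
  above `19` is principal** (`not_isPrincipal_span_nineteen`); `(a³ + 3a² + 5a + 8)(a³ − 3a² + 5a − 8) = −29` and
  **`(29, a² ∓ 8a + 6) = (a³ ± 3a² + 5a ± 8)` are principal** (`span_twentyNine_eq`);
* §5 **degree-two primes, continued**: `(2a³ − 2a² + 8a − 3)(2a³ + 2a² + 8a + 3) = −37` and **`(37, a² ∓ 7a + 9) = (2a³ ∓ 2a² + 8a ∓ 3)`
  are principal** (`span_thirtySeven_eq`); `(4a³ ± a² + 11a ± 2) = 𝔓₂·(59, a² ± 29a − 19)` (norms `6962 = 2·59²`), so **neither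
  prime above `59` is principal** (`span_x59_eq`, `not_isPrincipal_span_fiftyNine`);
* §6 `(a³ + 3a² + a + 12)(a³ − 3a² + a − 12) = −53` and **`(53, a² ∓ 12a + 22) = (a³ ± 3a² + a ± 12)` are principal**
  (`span_fiftyThree_eq`); `73` (shape `P₁P₂Q`, `r = 41`): `(5a² + 29) = 𝔓₂²(73, a − 29)(73, a + 29)`, `(5a² + 1) = 𝔓₂²(73, a² + 44)`,
  `(a² + a + 6) = 𝔓₂·(73, a − 29)` (norm `146`), so **`(73, a ∓ 29)` are NOT principal** (`span_seventyThree_factors`,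
  `not_isPrincipal_span_seventyThree`).

Together with `NonGaloisQuarticCMFieldClassNumber` §16–§19 the table of explicit classes reads: principal — `(7, a) = (a)`,
`(23, a ∓ 5)`, `(31, a ∓ 6)`, `(41, a ∓ 12)`, `(47, a ∓ 2)`, all four primes above `137`, every `(p, a² + 3 ± r)`; class `[𝔓₂]` —
`𝔓₂`, `(3, a² ∓ a − 1)`, `(7, a ∓ 1)`, `(17, a ∓ 5)`, `(19, a² ± 4a + 11)`, `(31, a ∓ 12)`, `(47, a ∓ 15)`, `(71, a ∓ 3)`, all four
primes above `193`, `(59, a² ± 29a − 19)`, `(73, a ∓ 29)`; also principal: `(29, a² ± 8a + 6)`, `(37, a² ± 7a + 9)`, `(53, a² ± 12a + 22)`.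
THEOREMS ONLY (no definitions, no named facts).
HC_CM is NOT proved and nothing here bears on it.
-/

noncomputable section

open Polynomial Module NumberField NumberField.IsCMField IsDedekindDomain
open scoped nonZeroDivisors

namespace Literature.NumberTheory.NumberFields

namespace NonGaloisQuarticCM

/-! ### §0. Helpers (in-file copies; see `NonGaloisQuarticCMFieldClassNumber` §1, §16, §17) -/

section Helpers

variable {s : 𝓞 (maximalRealSubfield KD)} (hs : ((s : maximalRealSubfield KD) : KD) = rs)
variable {a : 𝓞 KD} (ha : (a : KD) = ra)
variable (w₂ : HeightOneSpectrum (𝓞 KD)) [h₂ : w₂.asIdeal.LiesOver (Ideal.span {s})]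
include hs

/-- `a⁴ + 6a² + 7 = 0` in `𝓞_K`. [folklore] -/
private theorem ra_int_quartic (ha : (a : KD) = ra) : a ^ 4 + 6 * a ^ 2 + 7 = 0 := by
  have h := minpoly.aeval (𝓞 (maximalRealSubfield KD)) a
  rw [minpoly_ra_int hs ha, map_add, aeval_X_pow, aeval_C, map_add, map_ofNat] at h
  have hss : algebraMap (𝓞 (maximalRealSubfield KD)) (𝓞 KD) s * algebraMap (𝓞 (maximalRealSubfield KD)) (𝓞 KD) s = 2 := by
    rw [← map_mul, rs_int_mul_self hs, map_ofNat]
  have ha2 : a ^ 2 = -3 - algebraMap (𝓞 (maximalRealSubfield KD)) (𝓞 KD) s := by linear_combination h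
  have h4 : a ^ 4 = (a ^ 2) ^ 2 := by ring
  rw [h4, ha2]; linear_combination hss

/-- `(a² + 3) = 𝔓₂²` and `‖𝔓₂‖ = 2`. [folklore] -/
private theorem span_sq_add_three_eq (ha : (a : KD) = ra) :
    Ideal.span {(a ^ 2 + 3 : 𝓞 KD)} = w₂.asIdeal ^ 2 ∧ Ideal.absNorm w₂.asIdeal = 2 := by
  obtain ⟨w, -, huniq, -, hspan, hN⟩ := exists_prime_two' hs
  obtain rfl := huniq w₂ h₂
  have h := minpoly.aeval (𝓞 (maximalRealSubfield KD)) a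
  rw [minpoly_ra_int hs ha, map_add, aeval_X_pow, aeval_C, map_add, map_ofNat] at h
  refine ⟨?_, hN⟩
  rw [← hspan, show (a ^ 2 + 3 : 𝓞 KD) = -algebraMap (𝓞 (maximalRealSubfield KD)) (𝓞 KD) s by linear_combination h,
    Ideal.span_singleton_neg]

omit hs in
/-- `ā = −a` in `K`. [folklore] -/
private theorem complexConj_ra_copy' : IsCMField.complexConj KD ra = -ra := by
  apply (emb al al_quartic).injective
  rw [IsCMField.complexEmbedding_complexConj, map_neg, emb_ra, al, map_mul, Complex.conj_I, Complex.conj_ofReal, neg_mul]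

omit hs in
/-- On `𝓞_K`: `ā = −a`. [folklore] -/
private theorem conj_ra_int (ha : (a : KD) = ra) : ringOfIntegersComplexConj KD a = -a := by
  apply RingOfIntegers.ext
  rw [coe_ringOfIntegersComplexConj, RingOfIntegers.coe_eq_algebraMap, RingOfIntegers.coe_eq_algebraMap, map_neg,
    ← RingOfIntegers.coe_eq_algebraMap, ha, complexConj_ra_copy']

omit hs in
/-- `‖(x̄)‖ = ‖(x)‖`. [folklore] -/
private theorem absNorm_span_conj (x : 𝓞 KD) :
    Ideal.absNorm (Ideal.span {ringOfIntegersComplexConj KD x}) = Ideal.absNorm (Ideal.span {x}) := by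
  rw [Ideal.absNorm_span_singleton, Ideal.absNorm_span_singleton]
  congr 1
  exact Algebra.norm_eq_of_algEquiv ((ringOfIntegersComplexConj KD).restrictScalars ℤ) x

omit hs in
/-- `‖(n)‖ = n⁴`. [folklore] -/
private theorem absNorm_span_natCast (n : ℕ) : Ideal.absNorm (Ideal.span {(n : 𝓞 KD)}) = n ^ 4 := by
  rw [Ideal.absNorm_span_singleton]
  have h := Algebra.norm_algebraMap (S := 𝓞 KD) (n : ℤ)
  rw [RingOfIntegers.rank, finrank_KD, map_natCast] at h
  rw [h, Int.natAbs_pow, Int.natAbs_natCast]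

omit hs in
/-- Norm bookkeeping: `Y ≤ A`, `Z ≤ B`, `‖Y‖‖Z‖ = ‖A‖‖B‖ ≠ 0` force `Y = A` and `Z = B`. [folklore] -/
private theorem eq_and_eq_of_le_of_absNorm {Y Z A B : Ideal (𝓞 KD)} (hY : Y ≤ A) (hZ : Z ≤ B)
    (hN : Ideal.absNorm Y * Ideal.absNorm Z = Ideal.absNorm A * Ideal.absNorm B) (hA : Ideal.absNorm A ≠ 0)
    (hB : Ideal.absNorm B ≠ 0) : Y = A ∧ Z = B := by
  obtain ⟨m, hm⟩ := Ideal.absNorm_dvd_absNorm_of_le hY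
  obtain ⟨n, hn⟩ := Ideal.absNorm_dvd_absNorm_of_le hZ
  rw [hm, hn] at hN
  have hmn : m * n = 1 := by
    have h : Ideal.absNorm A * Ideal.absNorm B * (m * n) = Ideal.absNorm A * Ideal.absNorm B * 1 := by
      rw [mul_one]
      calc Ideal.absNorm A * Ideal.absNorm B * (m * n) = Ideal.absNorm A * m * (Ideal.absNorm B * n) := by ring
        _ = Ideal.absNorm A * Ideal.absNorm B := hN
    exact mul_left_cancel₀ (mul_ne_zero hA hB) h
  have hm1 : m = 1 := Nat.eq_one_of_mul_eq_one_right hmn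
  have hn1 : n = 1 := Nat.eq_one_of_mul_eq_one_left hmn
  rw [hm1, mul_one] at hm
  rw [hn1, mul_one] at hn
  have key : ∀ {I J : Ideal (𝓞 KD)}, I ≤ J → Ideal.absNorm I = Ideal.absNorm J → Ideal.absNorm J ≠ 0 → I = J := by
    intro I J hle hIJ hJ
    obtain ⟨L, hL⟩ := Ideal.dvd_iff_le.mpr hle
    have h := congrArg Ideal.absNorm hL
    rw [map_mul, hIJ] at h
    have hL1 : Ideal.absNorm L = 1 := by
      have h' : Ideal.absNorm J * Ideal.absNorm L = Ideal.absNorm J * 1 := by rw [mul_one]; exact h.symm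
      exact mul_left_cancel₀ hJ h'
    rw [Ideal.absNorm_eq_one_iff] at hL1
    rw [hL, hL1, Ideal.mul_top]
  exact ⟨key hY hm hA, key hZ hn hB⟩

omit hs in
/-- If `I·J = (g)` with `g ≠ 0`, then `I` is principal iff `J` is. [folklore] -/
private theorem isPrincipal_iff_of_mul_eq_span {I J : Ideal (𝓞 KD)} {g : 𝓞 KD} (hIJ : I * J = Ideal.span {g}) (hg : g ≠ 0) :
    I.IsPrincipal ↔ J.IsPrincipal := by
  have key : ∀ {I J : Ideal (𝓞 KD)}, I * J = Ideal.span {g} → I.IsPrincipal → J.IsPrincipal := by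
    intro I J hIJ hI
    obtain ⟨x, hx⟩ := (Submodule.IsPrincipal.principal I : ∃ x, I = Submodule.span (𝓞 KD) {x})
    change I = Ideal.span {x} at hx
    have hgI : g ∈ I := by
      have h : g ∈ I * J := by rw [hIJ]; exact Ideal.mem_span_singleton_self g
      exact Ideal.mul_le_right h
    rw [hx] at hgI
    obtain ⟨y, hy⟩ := Ideal.mem_span_singleton'.mp hgI
    have hx0 : Ideal.span {x} ≠ ⊥ := by
      rw [Ne, Ideal.span_singleton_eq_bot]; rintro rfl; rw [mul_zero] at hy; exact hg hy.symm
    have h : Ideal.span {x} * J = Ideal.span {x} * Ideal.span {y} := by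
      rw [Ideal.span_singleton_mul_span_singleton, mul_comm x y, hy, ← hIJ, hx]
    exact ⟨⟨y, mul_left_cancel₀ hx0 h⟩⟩
  exact ⟨key hIJ, key (by rw [mul_comm]; exact hIJ)⟩

end Helpers

/-! ### §1. Above `47` (totally split) and `71`: `(47, a ∓ 2) = (a ∓ 2)` principal, `(2a² + a + 5) = 𝔓₂·(47, a − 15)`,
`(a ∓ 3) = 𝔓₂·(71, a ∓ 3)` — so `(47, a ∓ 15)` and `(71, a ∓ 3)` are NOT principal

`47`: `r = 7`, `2² ≡ r − 3`, `15² ≡ −(r + 3)`; `(a − 2)(a + 2) = a² − 4` generates `(47, a − 2)(47, a + 2) = (47, a² − 4)` and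
`a² + 10` generates `(47, a² + 10) = (47, a − 15)(47, a + 15)` (`(a² − 4)(a² + 10) = (a⁴ + 6a² + 7) − 47`), so `‖(a ∓ 2)‖ = 47`;
`x = 2a² + a + 5` has `x x̄ = −(5a² + 3)` and `5a² + 3 = −(a² + 2)(a² + 3)(a² + 10)` (unit `−(a² + 2) = 1 + √2`), so
`(5a² + 3) = 𝔓₂²·(47, a − 15)(47, a + 15)`, `‖(x)‖ = 94` and `(x) = 𝔓₂·(47, a − 15)`.
`71`: `r = 12`, `3² ≡ r − 3`, `−(r + 3)` a non-residue; `a² − 9 = (a² + 3)(−6a² − 17)` with `−6a² − 17 = −6(a² − 9) − 71`, and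
`a² + 15 = (a² + 3)(6a² + 19)` with `6a² + 19 = 6(a² + 15) − 71`, `(a² − 9)(a² + 15) = (a⁴ + 6a² + 7) − 142`, so
`(a² − 9) = 𝔓₂²·(71, a − 3)(71, a + 3)` and `‖(a ∓ 3)‖ = 142`. -/

section ClassesFortySevenSeventyOne

variable {s : 𝓞 (maximalRealSubfield KD)} (hs : ((s : maximalRealSubfield KD) : KD) = rs)
variable {a : 𝓞 KD} (ha : (a : KD) = ra)
variable (w₂ : HeightOneSpectrum (𝓞 KD)) [h₂ : w₂.asIdeal.LiesOver (Ideal.span {s})]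
include hs

omit h₂ in
/-- **`47𝓞_K = (47, a − 2)(47, a + 2)(47, a − 15)(47, a + 15)`** (the second totally split prime), with
`(a² − 4) = (47, a − 2)(47, a + 2)`, `(a² + 10) = (47, a − 15)(47, a + 15)`, all four of norm `47`. [cite: Marcus2018, Ch. 3 Thm 27] -/
theorem span_fortySeven_factors (ha : (a : KD) = ra) :
    Ideal.span {(47 : 𝓞 KD)} =
      Ideal.span {(47 : 𝓞 KD), a - 2} * Ideal.span {(47 : 𝓞 KD), a + 2} *
        (Ideal.span {(47 : 𝓞 KD), a - 15} * Ideal.span {(47 : 𝓞 KD), a + 15}) ∧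
      Ideal.span {(a ^ 2 - 4 : 𝓞 KD)} = Ideal.span {(47 : 𝓞 KD), a - 2} * Ideal.span {(47 : 𝓞 KD), a + 2} ∧
      Ideal.span {(a ^ 2 + 10 : 𝓞 KD)} = Ideal.span {(47 : 𝓞 KD), a - 15} * Ideal.span {(47 : 𝓞 KD), a + 15} ∧
      (Ideal.absNorm (Ideal.span {(47 : 𝓞 KD), a - 2}) = 47 ∧ Ideal.absNorm (Ideal.span {(47 : 𝓞 KD), a + 2}) = 47) ∧
      Ideal.absNorm (Ideal.span {(47 : 𝓞 KD), a - 15}) = 47 ∧ Ideal.absNorm (Ideal.span {(47 : 𝓞 KD), a + 15}) = 47 := by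
  obtain ⟨h, h1, h2, h3, h4⟩ := span_natCast_eq_mul_four ha (p := 47) (by norm_num) (r := 7) (c := 2) (d := 15)
    (by decide) (by decide) (by decide)
  obtain ⟨hCC, hDD, -⟩ := span_sub_mul_span_add_eq_four ha (p := 47) (by norm_num) (r := 7) (c := 2) (d := 15)
    (by decide) (by decide) (by decide)
  have e1 : (a ^ 2 + 3 - ((7 : ℤ) : 𝓞 KD)) = a ^ 2 - 4 := by push_cast; ring
  have e2 : (a ^ 2 + 3 + ((7 : ℤ) : 𝓞 KD)) = a ^ 2 + 10 := by push_cast; ring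
  rw [e1] at hCC
  rw [e2] at hDD
  simp only [Nat.cast_ofNat, Int.cast_ofNat] at h h1 h2 h3 h4 hCC hDD
  have hNCC : Ideal.absNorm (Ideal.span {(47 : 𝓞 KD), a - 2} * Ideal.span {(47 : 𝓞 KD), a + 2}) = 47 ^ 2 := by
    rw [map_mul, h1.2, h2.2]; ring
  have hNDD : Ideal.absNorm (Ideal.span {(47 : 𝓞 KD), a - 15} * Ideal.span {(47 : 𝓞 KD), a + 15}) = 47 ^ 2 := by
    rw [map_mul, h3.2, h4.2]; ring
  have hY : Ideal.span {(a ^ 2 - 4 : 𝓞 KD)} ≤ Ideal.span {(47 : 𝓞 KD), a - 2} * Ideal.span {(47 : 𝓞 KD), a + 2} := by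
    rw [hCC, Ideal.span_singleton_le_iff_mem]; exact Ideal.subset_span (by simp)
  have hZ : Ideal.span {(a ^ 2 + 10 : 𝓞 KD)} ≤ Ideal.span {(47 : 𝓞 KD), a - 15} * Ideal.span {(47 : 𝓞 KD), a + 15} := by
    rw [hDD, Ideal.span_singleton_le_iff_mem]; exact Ideal.subset_span (by simp)
  have hprod : Ideal.span {(a ^ 2 - 4 : 𝓞 KD)} * Ideal.span {(a ^ 2 + 10 : 𝓞 KD)} = Ideal.span {((47 : ℕ) : 𝓞 KD)} := by
    rw [Ideal.span_singleton_mul_span_singleton, Nat.cast_ofNat,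
      show ((a ^ 2 - 4) * (a ^ 2 + 10) : 𝓞 KD) = -47 by linear_combination ra_int_quartic hs ha, Ideal.span_singleton_neg]
  have hN : Ideal.absNorm (Ideal.span {(a ^ 2 - 4 : 𝓞 KD)}) * Ideal.absNorm (Ideal.span {(a ^ 2 + 10 : 𝓞 KD)}) =
      Ideal.absNorm (Ideal.span {(47 : 𝓞 KD), a - 2} * Ideal.span {(47 : 𝓞 KD), a + 2}) *
        Ideal.absNorm (Ideal.span {(47 : 𝓞 KD), a - 15} * Ideal.span {(47 : 𝓞 KD), a + 15}) := by
    rw [← map_mul, hprod, absNorm_span_natCast, hNCC, hNDD]; norm_num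
  obtain ⟨hA, hB⟩ := eq_and_eq_of_le_of_absNorm hY hZ hN (by rw [hNCC]; norm_num) (by rw [hNDD]; norm_num)
  exact ⟨h, hA, hB, ⟨h1.2, h2.2⟩, h3.2, h4.2⟩

omit h₂ in
/-- **`(47, a − 2) = (a − 2)` and `(47, a + 2) = (a + 2)` are PRINCIPAL** (`‖(a ∓ 2)‖ = 47`: `X⁴ + 6X² + 7` takes the value `47`
at `±2`). [cite: Marcus2018, Ch. 5, discussion after Thm 37] -/
theorem span_fortySeven_sub_two_eq (ha : (a : KD) = ra) :
    Ideal.span {(47 : 𝓞 KD), a - 2} = Ideal.span {(a - 2 : 𝓞 KD)} ∧ Ideal.span {(47 : 𝓞 KD), a + 2} = Ideal.span {(a + 2 : 𝓞 KD)} ∧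
      (Ideal.span {(47 : 𝓞 KD), a - 2}).IsPrincipal ∧ (Ideal.span {(47 : 𝓞 KD), a + 2}).IsPrincipal := by
  obtain ⟨-, hfac, -, ⟨hN1, hN2⟩, -, -⟩ := span_fortySeven_factors hs ha
  have hconj : ringOfIntegersComplexConj KD (a - 2) = -(a + 2) := by rw [map_sub, conj_ra_int ha, map_ofNat]; ring
  have hxx : Ideal.span {(a - 2 : 𝓞 KD)} * Ideal.span {(a + 2 : 𝓞 KD)} = Ideal.span {(a ^ 2 - 4 : 𝓞 KD)} := by
    rw [Ideal.span_singleton_mul_span_singleton, show ((a - 2) * (a + 2) : 𝓞 KD) = a ^ 2 - 4 by ring]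
  have hNPP : Ideal.absNorm (Ideal.span {(47 : 𝓞 KD), a - 2} * Ideal.span {(47 : 𝓞 KD), a + 2}) = 47 ^ 2 := by
    rw [map_mul, hN1, hN2]; ring
  have hNc : Ideal.absNorm (Ideal.span {(a + 2 : 𝓞 KD)}) = Ideal.absNorm (Ideal.span {(a - 2 : 𝓞 KD)}) := by
    rw [← absNorm_span_conj (a - 2), hconj, Ideal.span_singleton_neg]
  have hNx : Ideal.absNorm (Ideal.span {(a - 2 : 𝓞 KD)}) = 47 := by
    have h := congrArg Ideal.absNorm hxx
    rw [map_mul, hNc, hfac, hNPP] at h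
    have h' : Ideal.absNorm (Ideal.span {(a - 2 : 𝓞 KD)}) ^ 2 = 47 ^ 2 := by rw [sq, h]
    exact Nat.pow_left_injective two_ne_zero h'
  have hNx' : Ideal.absNorm (Ideal.span {(a + 2 : 𝓞 KD)}) = 47 := by rw [hNc, hNx]
  have key : ∀ {I J : Ideal (𝓞 KD)}, I ≤ J → Ideal.absNorm I = Ideal.absNorm J → Ideal.absNorm J ≠ 0 → I = J := by
    intro I J hle hIJ hJ
    exact (eq_and_eq_of_le_of_absNorm hle hle (by rw [hIJ]) hJ hJ).1
  have h1 : Ideal.span {(a - 2 : 𝓞 KD)} = Ideal.span {(47 : 𝓞 KD), a - 2} :=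
    key (by rw [Ideal.span_singleton_le_iff_mem]; exact Ideal.subset_span (by simp)) (by rw [hNx, hN1]) (by rw [hN1]; norm_num)
  have h2 : Ideal.span {(a + 2 : 𝓞 KD)} = Ideal.span {(47 : 𝓞 KD), a + 2} :=
    key (by rw [Ideal.span_singleton_le_iff_mem]; exact Ideal.subset_span (by simp)) (by rw [hNx', hN2]) (by rw [hN2]; norm_num)
  exact ⟨h1.symm, h2.symm, ⟨⟨a - 2, h1.symm⟩⟩, ⟨⟨a + 2, h2.symm⟩⟩⟩

/-- **`(5a² + 3) = 𝔓₂²·(47, a − 15)(47, a + 15)` and `(2a² + a + 5) = 𝔓₂·(47, a − 15)`** (`‖(2a² + a + 5)‖ = 94`;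
`2a² + a + 5 = (a − 15)(2a + 31) + 10·47 = (a − 1)(2a + 3) + 8`). [cite: Marcus2018, Ch. 5, discussion after Thm 37] -/
theorem span_x47_eq (ha : (a : KD) = ra) :
    Ideal.span {(5 * a ^ 2 + 3 : 𝓞 KD)} = w₂.asIdeal ^ 2 * (Ideal.span {(47 : 𝓞 KD), a - 15} * Ideal.span {(47 : 𝓞 KD), a + 15}) ∧
      Ideal.span {(2 * a ^ 2 + a + 5 : 𝓞 KD)} = w₂.asIdeal * Ideal.span {(47 : 𝓞 KD), a - 15} ∧
      Ideal.absNorm (Ideal.span {(2 * a ^ 2 + a + 5 : 𝓞 KD)}) = 94 := by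
  obtain ⟨-, hCC, hDD, ⟨hN1, hN1'⟩, hN3, hN4⟩ := span_fortySeven_factors hs ha
  obtain ⟨hs3, hN2⟩ := span_sq_add_three_eq hs w₂ ha
  have hNCC : Ideal.absNorm (Ideal.span {(47 : 𝓞 KD), a - 2} * Ideal.span {(47 : 𝓞 KD), a + 2}) = 47 ^ 2 := by
    rw [map_mul, hN1, hN1']; ring
  have hNDD : Ideal.absNorm (Ideal.span {(47 : 𝓞 KD), a - 15} * Ideal.span {(47 : 𝓞 KD), a + 15}) = 47 ^ 2 := by
    rw [map_mul, hN3, hN4]; ring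
  have hNw2 : Ideal.absNorm (w₂.asIdeal ^ 2) = 4 := by rw [map_pow, hN2]; norm_num
  -- `5a² + 3 = −(a² + 2)·(a² + 3)(a² + 10)` and `5a² + 27 = −(a² + 4)·(a² + 3)(a² − 4)` (the cofactors are units)
  have hY : Ideal.span {(5 * a ^ 2 + 3 : 𝓞 KD)} ≤
      w₂.asIdeal ^ 2 * (Ideal.span {(47 : 𝓞 KD), a - 15} * Ideal.span {(47 : 𝓞 KD), a + 15}) := by
    rw [← hs3, ← hDD, Ideal.span_singleton_mul_span_singleton, Ideal.span_singleton_le_iff_mem]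
    exact Ideal.mem_span_singleton'.mpr ⟨-(a ^ 2 + 2), by linear_combination (-a ^ 2 - 9 : 𝓞 KD) * ra_int_quartic hs ha⟩
  have hZ : Ideal.span {(5 * a ^ 2 + 27 : 𝓞 KD)} ≤
      w₂.asIdeal ^ 2 * (Ideal.span {(47 : 𝓞 KD), a - 2} * Ideal.span {(47 : 𝓞 KD), a + 2}) := by
    rw [← hs3, ← hCC, Ideal.span_singleton_mul_span_singleton, Ideal.span_singleton_le_iff_mem]
    exact Ideal.mem_span_singleton'.mpr ⟨-(a ^ 2 + 4), by linear_combination (3 - a ^ 2 : 𝓞 KD) * ra_int_quartic hs ha⟩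
  have hprod : Ideal.span {(5 * a ^ 2 + 3 : 𝓞 KD)} * Ideal.span {(5 * a ^ 2 + 27 : 𝓞 KD)} = Ideal.span {((94 : ℕ) : 𝓞 KD)} := by
    rw [Ideal.span_singleton_mul_span_singleton, Nat.cast_ofNat,
      show ((5 * a ^ 2 + 3) * (5 * a ^ 2 + 27) : 𝓞 KD) = -94 by linear_combination (25 : 𝓞 KD) * ra_int_quartic hs ha,
      Ideal.span_singleton_neg]
  have hNA : Ideal.absNorm (w₂.asIdeal ^ 2 * (Ideal.span {(47 : 𝓞 KD), a - 15} * Ideal.span {(47 : 𝓞 KD), a + 15})) =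
      4 * 47 ^ 2 := by
    rw [map_mul, hNw2, hNDD]
  have hNB : Ideal.absNorm (w₂.asIdeal ^ 2 * (Ideal.span {(47 : 𝓞 KD), a - 2} * Ideal.span {(47 : 𝓞 KD), a + 2})) =
      4 * 47 ^ 2 := by
    rw [map_mul, hNw2, hNCC]
  have hN : Ideal.absNorm (Ideal.span {(5 * a ^ 2 + 3 : 𝓞 KD)}) * Ideal.absNorm (Ideal.span {(5 * a ^ 2 + 27 : 𝓞 KD)}) =
      Ideal.absNorm (w₂.asIdeal ^ 2 * (Ideal.span {(47 : 𝓞 KD), a - 15} * Ideal.span {(47 : 𝓞 KD), a + 15})) *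
        Ideal.absNorm (w₂.asIdeal ^ 2 * (Ideal.span {(47 : 𝓞 KD), a - 2} * Ideal.span {(47 : 𝓞 KD), a + 2})) := by
    rw [← map_mul, hprod, absNorm_span_natCast, hNA, hNB]; norm_num
  obtain ⟨hA, -⟩ := eq_and_eq_of_le_of_absNorm hY hZ hN (by rw [hNA]; norm_num) (by rw [hNB]; norm_num)
  have hconj : ringOfIntegersComplexConj KD (2 * a ^ 2 + a + 5) = 2 * a ^ 2 - a + 5 := by
    rw [map_add, map_add, map_mul, map_pow, conj_ra_int ha, map_ofNat, map_ofNat]; ring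
  have hxx : Ideal.span {(2 * a ^ 2 + a + 5 : 𝓞 KD)} * Ideal.span {(2 * a ^ 2 - a + 5 : 𝓞 KD)} =
      Ideal.span {(5 * a ^ 2 + 3 : 𝓞 KD)} := by
    rw [Ideal.span_singleton_mul_span_singleton,
      show ((2 * a ^ 2 + a + 5) * (2 * a ^ 2 - a + 5) : 𝓞 KD) = -(5 * a ^ 2 + 3) by
        linear_combination (4 : 𝓞 KD) * ra_int_quartic hs ha,
      Ideal.span_singleton_neg]
  have hNx : Ideal.absNorm (Ideal.span {(2 * a ^ 2 + a + 5 : 𝓞 KD)}) = 94 := by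
    have h := congrArg Ideal.absNorm hxx
    rw [map_mul, ← hconj, absNorm_span_conj, hA, hNA] at h
    have h' : Ideal.absNorm (Ideal.span {(2 * a ^ 2 + a + 5 : 𝓞 KD)}) ^ 2 = 94 ^ 2 := by rw [sq, h]; norm_num
    exact Nat.pow_left_injective two_ne_zero h'
  refine ⟨hA, ?_, hNx⟩
  have hprime : (Ideal.span {(47 : 𝓞 KD), a - 15}).IsPrime := by
    have h := (isPrime_span_pair_sub_and_absNorm ha (p := 47) (by norm_num) (c := 15) (by decide)).1
    simp only [Nat.cast_ofNat, Int.cast_ofNat] at h; exact h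
  haveI := hprime
  have hP0 : Ideal.span {(47 : 𝓞 KD), a - 15} ≠ ⊥ := by
    intro h; rw [h, Ideal.absNorm_bot] at hN3; norm_num at hN3
  have hPw : Ideal.span {(47 : 𝓞 KD), a - 15} ≠ w₂.asIdeal := by
    intro h; rw [h, hN2] at hN3; norm_num at hN3
  refine span_eq_w₂_mul_of_mem hs w₂ hP0 hPw (Ideal.mem_span_pair.mpr ⟨10, 2 * a + 31, by ring⟩) ?_ (by norm_num [hNx, hN3])
  rw [w₂_eq_span_pair hs w₂ ha]
  exact Ideal.mem_span_pair.mpr ⟨4, 2 * a + 3, by ring⟩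

omit h₂ in
/-- **`(47, a − 15)` and `(47, a + 15)` are NOT principal** (class `[𝔓₂]`), while `(47, a ∓ 2) = (a ∓ 2)` are: as above `31`,
both classes occur twice above the totally split prime `47`. [cite: Marcus2018, Ch. 5, discussion after Thm 37] -/
theorem not_isPrincipal_span_fortySeven (ha : (a : KD) = ra) :
    ¬ (Ideal.span {(47 : 𝓞 KD), a - 15}).IsPrincipal ∧ ¬ (Ideal.span {(47 : 𝓞 KD), a + 15}).IsPrincipal := by
  obtain ⟨w, hw, -⟩ := exists_prime_two' hs
  haveI := hw
  obtain ⟨-, hx, hNx⟩ := span_x47_eq hs w ha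
  have hx0 : (2 * a ^ 2 + a + 5 : 𝓞 KD) ≠ 0 := by
    intro h; rw [h, Ideal.span_singleton_eq_bot.mpr rfl, Ideal.absNorm_bot] at hNx; norm_num at hNx
  have h1 : ¬ (Ideal.span {(47 : 𝓞 KD), a - 15}).IsPrincipal :=
    fun h => not_isPrincipal_w₂ hs w ((isPrincipal_iff_of_mul_eq_span hx.symm hx0).mpr h)
  have hiff := (isPrincipal_span_pair_sub_iff_four hs ha (p := 47) (by norm_num) (r := 7) (c := 2) (d := 15)
    (by decide) (by decide) (by decide)).2
  simp only [Nat.cast_ofNat, Int.cast_ofNat] at hiff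
  exact ⟨h1, fun h => h1 (hiff.mpr h)⟩

/-- **`71𝓞_K = (71, a − 3)(71, a + 3)(71, a² + 15)`** with **`(a² − 9) = 𝔓₂²·(71, a − 3)(71, a + 3)`**,
**`(a² + 15) = 𝔓₂²·(71, a² + 15)`**, and **`(a − 3) = 𝔓₂·(71, a − 3)`, `(a + 3) = 𝔓₂·(71, a + 3)`** (`‖(a ∓ 3)‖ = 142`:
`X⁴ + 6X² + 7` takes the value `142` at `±3`). [cite: Marcus2018, Ch. 3 Thm 27] [cite: Marcus2018, Ch. 5, discussion after Thm 37] -/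
theorem span_seventyOne_factors (ha : (a : KD) = ra) :
    Ideal.span {(71 : 𝓞 KD)} =
      Ideal.span {(71 : 𝓞 KD), a - 3} * Ideal.span {(71 : 𝓞 KD), a + 3} * Ideal.span {(71 : 𝓞 KD), a ^ 2 + 15} ∧
      Ideal.span {(a ^ 2 - 9 : 𝓞 KD)} = w₂.asIdeal ^ 2 * (Ideal.span {(71 : 𝓞 KD), a - 3} * Ideal.span {(71 : 𝓞 KD), a + 3}) ∧
      Ideal.span {(a ^ 2 + 15 : 𝓞 KD)} = w₂.asIdeal ^ 2 * Ideal.span {(71 : 𝓞 KD), a ^ 2 + 15} ∧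
      Ideal.span {(a - 3 : 𝓞 KD)} = w₂.asIdeal * Ideal.span {(71 : 𝓞 KD), a - 3} ∧
      Ideal.span {(a + 3 : 𝓞 KD)} = w₂.asIdeal * Ideal.span {(71 : 𝓞 KD), a + 3} := by
  obtain ⟨h, h1, h2, h3⟩ := span_natCast_eq_mul_three ha (p := 71) (by norm_num) (r := 12) (c := 3)
    (by decide) (by decide) (by decide)
  obtain ⟨hPP, -⟩ := span_sub_mul_span_add_eq_three ha (p := 71) (by norm_num) (r := 12) (c := 3)
    (by decide) (by decide) (by decide)
  obtain ⟨hs3, hN2⟩ := span_sq_add_three_eq hs w₂ ha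
  have e1 : (a ^ 2 + 3 + ((12 : ℤ) : 𝓞 KD)) = a ^ 2 + 15 := by push_cast; ring
  have e2 : (a ^ 2 + 3 - ((12 : ℤ) : 𝓞 KD)) = a ^ 2 - 9 := by push_cast; ring
  rw [e1] at h h3
  rw [e2] at hPP
  simp only [Nat.cast_ofNat, Int.cast_ofNat] at h h1 h2 h3 hPP
  have hNPP : Ideal.absNorm (Ideal.span {(71 : 𝓞 KD), a - 3} * Ideal.span {(71 : 𝓞 KD), a + 3}) = 71 ^ 2 := by
    rw [map_mul, h1.2, h2.2]; ring
  have hNw2 : Ideal.absNorm (w₂.asIdeal ^ 2) = 4 := by rw [map_pow, hN2]; norm_num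
  -- `a² − 9 = (a² + 3)(−6a² − 17)` with `−6a² − 17 = −71 − 6(a² − 9)`; `a² + 15 = (a² + 3)(6a² + 19)`, `6a² + 19 = 6(a² + 15) − 71`
  have f1 : (a ^ 2 - 9 : 𝓞 KD) = (a ^ 2 + 3) * (-6 * a ^ 2 - 17) := by
    linear_combination (6 : 𝓞 KD) * ra_int_quartic hs ha
  have f2 : (a ^ 2 + 15 : 𝓞 KD) = (a ^ 2 + 3) * (6 * a ^ 2 + 19) := by
    linear_combination (-6 : 𝓞 KD) * ra_int_quartic hs ha
  have hY : Ideal.span {(a ^ 2 - 9 : 𝓞 KD)} ≤ w₂.asIdeal ^ 2 * (Ideal.span {(71 : 𝓞 KD), a - 3} * Ideal.span {(71 : 𝓞 KD), a + 3}) := by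
    rw [← hs3, hPP, Ideal.span_singleton_le_iff_mem]
    have hmem : (a ^ 2 + 3) * (-6 * a ^ 2 - 17) ∈ Ideal.span {(a ^ 2 + 3 : 𝓞 KD)} * Ideal.span {(71 : 𝓞 KD), a ^ 2 - 9} :=
      Ideal.mul_mem_mul (Ideal.mem_span_singleton_self _) (Ideal.mem_span_pair.mpr ⟨-1, -6, by ring⟩)
    rwa [← f1] at hmem
  have hZ : Ideal.span {(a ^ 2 + 15 : 𝓞 KD)} ≤ w₂.asIdeal ^ 2 * Ideal.span {(71 : 𝓞 KD), a ^ 2 + 15} := by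
    rw [← hs3, Ideal.span_singleton_le_iff_mem]
    have hmem : (a ^ 2 + 3) * (6 * a ^ 2 + 19) ∈ Ideal.span {(a ^ 2 + 3 : 𝓞 KD)} * Ideal.span {(71 : 𝓞 KD), a ^ 2 + 15} :=
      Ideal.mul_mem_mul (Ideal.mem_span_singleton_self _) (Ideal.mem_span_pair.mpr ⟨-1, 6, by ring⟩)
    rwa [← f2] at hmem
  have hprod : Ideal.span {(a ^ 2 - 9 : 𝓞 KD)} * Ideal.span {(a ^ 2 + 15 : 𝓞 KD)} = Ideal.span {((142 : ℕ) : 𝓞 KD)} := by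
    rw [Ideal.span_singleton_mul_span_singleton, Nat.cast_ofNat,
      show ((a ^ 2 - 9) * (a ^ 2 + 15) : 𝓞 KD) = -142 by linear_combination ra_int_quartic hs ha, Ideal.span_singleton_neg]
  have hNA : Ideal.absNorm (w₂.asIdeal ^ 2 * (Ideal.span {(71 : 𝓞 KD), a - 3} * Ideal.span {(71 : 𝓞 KD), a + 3})) =
      4 * 71 ^ 2 := by
    rw [map_mul, hNw2, hNPP]
  have hNB : Ideal.absNorm (w₂.asIdeal ^ 2 * Ideal.span {(71 : 𝓞 KD), a ^ 2 + 15}) = 4 * 71 ^ 2 := by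
    rw [map_mul, hNw2, h3.2]
  have hN : Ideal.absNorm (Ideal.span {(a ^ 2 - 9 : 𝓞 KD)}) * Ideal.absNorm (Ideal.span {(a ^ 2 + 15 : 𝓞 KD)}) =
      Ideal.absNorm (w₂.asIdeal ^ 2 * (Ideal.span {(71 : 𝓞 KD), a - 3} * Ideal.span {(71 : 𝓞 KD), a + 3})) *
        Ideal.absNorm (w₂.asIdeal ^ 2 * Ideal.span {(71 : 𝓞 KD), a ^ 2 + 15}) := by
    rw [← map_mul, hprod, absNorm_span_natCast, hNA, hNB]; norm_num
  obtain ⟨hA, hB⟩ := eq_and_eq_of_le_of_absNorm hY hZ hN (by rw [hNA]; norm_num) (by rw [hNB]; norm_num)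
  -- norms of `(a ∓ 3)`
  have hconj : ringOfIntegersComplexConj KD (a - 3) = -(a + 3) := by rw [map_sub, conj_ra_int ha, map_ofNat]; ring
  have hxx : Ideal.span {(a - 3 : 𝓞 KD)} * Ideal.span {(a + 3 : 𝓞 KD)} = Ideal.span {(a ^ 2 - 9 : 𝓞 KD)} := by
    rw [Ideal.span_singleton_mul_span_singleton, show ((a - 3) * (a + 3) : 𝓞 KD) = a ^ 2 - 9 by ring]
  have hNc : Ideal.absNorm (Ideal.span {(a + 3 : 𝓞 KD)}) = Ideal.absNorm (Ideal.span {(a - 3 : 𝓞 KD)}) := by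
    rw [← absNorm_span_conj (a - 3), hconj, Ideal.span_singleton_neg]
  have hNx : Ideal.absNorm (Ideal.span {(a - 3 : 𝓞 KD)}) = 142 := by
    have h := congrArg Ideal.absNorm hxx
    rw [map_mul, hNc, hA, hNA] at h
    have h' : Ideal.absNorm (Ideal.span {(a - 3 : 𝓞 KD)}) ^ 2 = 142 ^ 2 := by rw [sq, h]; norm_num
    exact Nat.pow_left_injective two_ne_zero h'
  have hNx' : Ideal.absNorm (Ideal.span {(a + 3 : 𝓞 KD)}) = 142 := by rw [hNc, hNx]
  haveI := h1.1; haveI := h2.1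
  have hw := w₂_eq_span_pair hs w₂ ha
  refine ⟨h, hA, hB, ?_, ?_⟩
  · refine span_eq_w₂_mul_of_mem hs w₂ (by intro h0; rw [h0, Ideal.absNorm_bot] at h1; norm_num at h1)
      (by intro h0; rw [h0, hN2] at h1; norm_num at h1) (Ideal.subset_span (by simp)) ?_ (by norm_num [hNx, h1.2])
    rw [hw]; exact Ideal.mem_span_pair.mpr ⟨-1, 1, by ring⟩
  · refine span_eq_w₂_mul_of_mem hs w₂ (by intro h0; rw [h0, Ideal.absNorm_bot] at h2; norm_num at h2)
      (by intro h0; rw [h0, hN2] at h2; norm_num at h2) (Ideal.subset_span (by simp)) ?_ (by norm_num [hNx', h2.2])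
    rw [hw]; exact Ideal.mem_span_pair.mpr ⟨2, 1, by ring⟩

omit h₂ in
/-- **`(71, a − 3)` and `(71, a + 3)` are NOT principal** (they are `𝔓₂⁻¹(a ∓ 3) ∈ [𝔓₂]`). [cite: Marcus2018, Ch. 5, discussion after Thm 37] -/
theorem not_isPrincipal_span_seventyOne (ha : (a : KD) = ra) :
    ¬ (Ideal.span {(71 : 𝓞 KD), a - 3}).IsPrincipal ∧ ¬ (Ideal.span {(71 : 𝓞 KD), a + 3}).IsPrincipal := by
  obtain ⟨w, hw, -⟩ := exists_prime_two' hs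
  haveI := hw
  obtain ⟨-, -, -, hx1, hx2⟩ := span_seventyOne_factors hs w ha
  have hP0 : ∀ t : 𝓞 KD, Ideal.span {(71 : 𝓞 KD), t} ≠ ⊥ := by
    intro t h0
    have h71 : (71 : 𝓞 KD) ∈ Ideal.span {(71 : 𝓞 KD), t} := Ideal.subset_span (by simp)
    rw [h0, Ideal.mem_bot] at h71
    have h := congrArg (fun z : 𝓞 KD => (z : KD)) h71
    push_cast at h
    norm_num at h
  have ha3 : (a - 3 : 𝓞 KD) ≠ 0 := by
    intro h0
    rw [h0, Ideal.span_singleton_eq_bot.mpr rfl, eq_comm, Ideal.mul_eq_bot] at hx1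
    exact hx1.elim w.ne_bot (hP0 _)
  have ha3' : (a + 3 : 𝓞 KD) ≠ 0 := by
    intro h0
    rw [h0, Ideal.span_singleton_eq_bot.mpr rfl, eq_comm, Ideal.mul_eq_bot] at hx2
    exact hx2.elim w.ne_bot (hP0 _)
  exact ⟨fun h => not_isPrincipal_w₂ hs w ((isPrincipal_iff_of_mul_eq_span hx1.symm ha3).mpr h),
    fun h => not_isPrincipal_w₂ hs w ((isPrincipal_iff_of_mul_eq_span hx2.symm ha3').mpr h)⟩

end ClassesFortySevenSeventyOne

/-! ### §2. `137`: the smallest prime that splits completely into four PRINCIPAL primes: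
`(137, a ∓ 68) = (2a ± 1)`, `(137, a ∓ 24) = (a³ ± a² + 5a ± 2)`

`r = 106` (`106² ≡ 2`), `68² ≡ r − 3`, `24² ≡ −(r + 3)`; `(4a² − 1) = (137, a − 68)(137, a + 68)`, `(4a² + 25) = (137, a − 24)(137, a + 24)`
(`(4a² − 1)(4a² + 25) = 16(a⁴ + 6a² + 7) − 137`); `(2a + 1)(2a − 1) = 4a² − 1`, and `g = a³ + a² + 5a + 2` has
`g·ḡ = 4a² + 25` (`ḡ = −(a³ − a² + 5a − 2)`). -/

section ClassesOneThirtySeven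

variable {s : 𝓞 (maximalRealSubfield KD)} (hs : ((s : maximalRealSubfield KD) : KD) = rs)
variable {a : 𝓞 KD} (ha : (a : KD) = ra)
include hs

/-- **`137𝓞_K = (137, a − 68)(137, a + 68)(137, a − 24)(137, a + 24)`** with `(4a² − 1) = (137, a − 68)(137, a + 68)` and
`(4a² + 25) = (137, a − 24)(137, a + 24)`, all four of norm `137`. [cite: Marcus2018, Ch. 3 Thm 27] -/
theorem span_oneThirtySeven_factors (ha : (a : KD) = ra) :
    Ideal.span {(137 : 𝓞 KD)} =
      Ideal.span {(137 : 𝓞 KD), a - 68} * Ideal.span {(137 : 𝓞 KD), a + 68} *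
        (Ideal.span {(137 : 𝓞 KD), a - 24} * Ideal.span {(137 : 𝓞 KD), a + 24}) ∧
      Ideal.span {(4 * a ^ 2 - 1 : 𝓞 KD)} = Ideal.span {(137 : 𝓞 KD), a - 68} * Ideal.span {(137 : 𝓞 KD), a + 68} ∧
      Ideal.span {(4 * a ^ 2 + 25 : 𝓞 KD)} = Ideal.span {(137 : 𝓞 KD), a - 24} * Ideal.span {(137 : 𝓞 KD), a + 24} ∧
      (Ideal.absNorm (Ideal.span {(137 : 𝓞 KD), a - 68}) = 137 ∧ Ideal.absNorm (Ideal.span {(137 : 𝓞 KD), a + 68}) = 137) ∧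
      Ideal.absNorm (Ideal.span {(137 : 𝓞 KD), a - 24}) = 137 ∧ Ideal.absNorm (Ideal.span {(137 : 𝓞 KD), a + 24}) = 137 := by
  obtain ⟨h, h1, h2, h3, h4⟩ := span_natCast_eq_mul_four ha (p := 137) (by norm_num) (r := 106) (c := 68) (d := 24)
    (by decide) (by decide) (by decide)
  obtain ⟨hCC, hDD, -⟩ := span_sub_mul_span_add_eq_four ha (p := 137) (by norm_num) (r := 106) (c := 68) (d := 24)
    (by decide) (by decide) (by decide)
  have e1 : (a ^ 2 + 3 - ((106 : ℤ) : 𝓞 KD)) = a ^ 2 - 103 := by push_cast; ring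
  have e2 : (a ^ 2 + 3 + ((106 : ℤ) : 𝓞 KD)) = a ^ 2 + 109 := by push_cast; ring
  rw [e1] at hCC
  rw [e2] at hDD
  simp only [Nat.cast_ofNat, Int.cast_ofNat] at h h1 h2 h3 h4 hCC hDD
  have hNCC : Ideal.absNorm (Ideal.span {(137 : 𝓞 KD), a - 68} * Ideal.span {(137 : 𝓞 KD), a + 68}) = 137 ^ 2 := by
    rw [map_mul, h1.2, h2.2]; ring
  have hNDD : Ideal.absNorm (Ideal.span {(137 : 𝓞 KD), a - 24} * Ideal.span {(137 : 𝓞 KD), a + 24}) = 137 ^ 2 := by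
    rw [map_mul, h3.2, h4.2]; ring
  have hY : Ideal.span {(4 * a ^ 2 - 1 : 𝓞 KD)} ≤ Ideal.span {(137 : 𝓞 KD), a - 68} * Ideal.span {(137 : 𝓞 KD), a + 68} := by
    rw [hCC, Ideal.span_singleton_le_iff_mem]; exact Ideal.mem_span_pair.mpr ⟨3, 4, by ring⟩
  have hZ : Ideal.span {(4 * a ^ 2 + 25 : 𝓞 KD)} ≤ Ideal.span {(137 : 𝓞 KD), a - 24} * Ideal.span {(137 : 𝓞 KD), a + 24} := by
    rw [hDD, Ideal.span_singleton_le_iff_mem]; exact Ideal.mem_span_pair.mpr ⟨-3, 4, by ring⟩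
  have hprod : Ideal.span {(4 * a ^ 2 - 1 : 𝓞 KD)} * Ideal.span {(4 * a ^ 2 + 25 : 𝓞 KD)} = Ideal.span {((137 : ℕ) : 𝓞 KD)} := by
    rw [Ideal.span_singleton_mul_span_singleton, Nat.cast_ofNat,
      show ((4 * a ^ 2 - 1) * (4 * a ^ 2 + 25) : 𝓞 KD) = -137 by linear_combination (16 : 𝓞 KD) * ra_int_quartic hs ha,
      Ideal.span_singleton_neg]
  have hN : Ideal.absNorm (Ideal.span {(4 * a ^ 2 - 1 : 𝓞 KD)}) * Ideal.absNorm (Ideal.span {(4 * a ^ 2 + 25 : 𝓞 KD)}) =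
      Ideal.absNorm (Ideal.span {(137 : 𝓞 KD), a - 68} * Ideal.span {(137 : 𝓞 KD), a + 68}) *
        Ideal.absNorm (Ideal.span {(137 : 𝓞 KD), a - 24} * Ideal.span {(137 : 𝓞 KD), a + 24}) := by
    rw [← map_mul, hprod, absNorm_span_natCast, hNCC, hNDD]; norm_num
  obtain ⟨hA, hB⟩ := eq_and_eq_of_le_of_absNorm hY hZ hN (by rw [hNCC]; norm_num) (by rw [hNDD]; norm_num)
  exact ⟨h, hA, hB, ⟨h1.2, h2.2⟩, h3.2, h4.2⟩

/-- **All four primes above `137` are principal: `(137, a − 68) = (2a + 1)`, `(137, a + 68) = (2a − 1)`,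
`(137, a − 24) = (a³ + a² + 5a + 2)`, `(137, a + 24) = (a³ − a² + 5a − 2)`** (`‖(2a ± 1)‖ = 137`: `(2a + 1)(2a − 1) = 4a² − 1`;
`g ḡ = 4a² + 25` for `g = a³ + a² + 5a + 2`; `2a + 1 = 2(a − 68) + 137`, `g = (a − 24)(a² + 25a + 605) + 106·137`).  By the
table of `NonGaloisQuarticCMFieldClassNumber` §17–§19 and §1 here, `137` is the smallest rational prime all of whose prime divisors in
`K` are principal of degree one. [cite: Marcus2018, Ch. 5, discussion after Thm 37] -/
theorem span_oneThirtySeven_eq (ha : (a : KD) = ra) :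
    Ideal.span {(137 : 𝓞 KD), a - 68} = Ideal.span {(2 * a + 1 : 𝓞 KD)} ∧
      Ideal.span {(137 : 𝓞 KD), a + 68} = Ideal.span {(2 * a - 1 : 𝓞 KD)} ∧
      Ideal.span {(137 : 𝓞 KD), a - 24} = Ideal.span {(a ^ 3 + a ^ 2 + 5 * a + 2 : 𝓞 KD)} ∧
      Ideal.span {(137 : 𝓞 KD), a + 24} = Ideal.span {(a ^ 3 - a ^ 2 + 5 * a - 2 : 𝓞 KD)} ∧
      (Ideal.span {(137 : 𝓞 KD), a - 68}).IsPrincipal ∧ (Ideal.span {(137 : 𝓞 KD), a + 68}).IsPrincipal ∧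
      (Ideal.span {(137 : 𝓞 KD), a - 24}).IsPrincipal ∧ (Ideal.span {(137 : 𝓞 KD), a + 24}).IsPrincipal := by
  obtain ⟨-, hCC, hDD, ⟨hN1, hN2⟩, hN3, hN4⟩ := span_oneThirtySeven_factors hs ha
  have hNCC : Ideal.absNorm (Ideal.span {(137 : 𝓞 KD), a - 68} * Ideal.span {(137 : 𝓞 KD), a + 68}) = 137 ^ 2 := by
    rw [map_mul, hN1, hN2]; ring
  have hNDD : Ideal.absNorm (Ideal.span {(137 : 𝓞 KD), a - 24} * Ideal.span {(137 : 𝓞 KD), a + 24}) = 137 ^ 2 := by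
    rw [map_mul, hN3, hN4]; ring
  have key : ∀ {I J : Ideal (𝓞 KD)}, I ≤ J → Ideal.absNorm I = Ideal.absNorm J → Ideal.absNorm J ≠ 0 → I = J := by
    intro I J hle hIJ hJ
    exact (eq_and_eq_of_le_of_absNorm hle hle (by rw [hIJ]) hJ hJ).1
  -- the pair `(2a ± 1)`
  have hconj1 : ringOfIntegersComplexConj KD (2 * a + 1) = -(2 * a - 1) := by
    rw [map_add, map_mul, conj_ra_int ha, map_ofNat, map_one]; ring
  have hxx1 : Ideal.span {(2 * a + 1 : 𝓞 KD)} * Ideal.span {(2 * a - 1 : 𝓞 KD)} = Ideal.span {(4 * a ^ 2 - 1 : 𝓞 KD)} := by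
    rw [Ideal.span_singleton_mul_span_singleton, show ((2 * a + 1) * (2 * a - 1) : 𝓞 KD) = 4 * a ^ 2 - 1 by ring]
  have hNc1 : Ideal.absNorm (Ideal.span {(2 * a - 1 : 𝓞 KD)}) = Ideal.absNorm (Ideal.span {(2 * a + 1 : 𝓞 KD)}) := by
    rw [← absNorm_span_conj (2 * a + 1), hconj1, Ideal.span_singleton_neg]
  have hNx1 : Ideal.absNorm (Ideal.span {(2 * a + 1 : 𝓞 KD)}) = 137 := by
    have h := congrArg Ideal.absNorm hxx1
    rw [map_mul, hNc1, hCC, hNCC] at h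
    have h' : Ideal.absNorm (Ideal.span {(2 * a + 1 : 𝓞 KD)}) ^ 2 = 137 ^ 2 := by rw [sq, h]
    exact Nat.pow_left_injective two_ne_zero h'
  have hNx1' : Ideal.absNorm (Ideal.span {(2 * a - 1 : 𝓞 KD)}) = 137 := by rw [hNc1, hNx1]
  have h1 : Ideal.span {(2 * a + 1 : 𝓞 KD)} = Ideal.span {(137 : 𝓞 KD), a - 68} :=
    key (by rw [Ideal.span_singleton_le_iff_mem]; exact Ideal.mem_span_pair.mpr ⟨1, 2, by ring⟩)
      (by rw [hNx1, hN1]) (by rw [hN1]; norm_num)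
  have h2 : Ideal.span {(2 * a - 1 : 𝓞 KD)} = Ideal.span {(137 : 𝓞 KD), a + 68} :=
    key (by rw [Ideal.span_singleton_le_iff_mem]; exact Ideal.mem_span_pair.mpr ⟨-1, 2, by ring⟩)
      (by rw [hNx1', hN2]) (by rw [hN2]; norm_num)
  -- the pair `(a³ ± a² + 5a ± 2)`
  have hconj2 : ringOfIntegersComplexConj KD (a ^ 3 + a ^ 2 + 5 * a + 2) = -(a ^ 3 - a ^ 2 + 5 * a - 2) := by
    rw [map_add, map_add, map_add, map_pow, map_pow, map_mul, conj_ra_int ha, map_ofNat, map_ofNat]; ring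
  have hxx2 : Ideal.span {(a ^ 3 + a ^ 2 + 5 * a + 2 : 𝓞 KD)} * Ideal.span {(a ^ 3 - a ^ 2 + 5 * a - 2 : 𝓞 KD)} =
      Ideal.span {(4 * a ^ 2 + 25 : 𝓞 KD)} := by
    rw [Ideal.span_singleton_mul_span_singleton,
      show ((a ^ 3 + a ^ 2 + 5 * a + 2) * (a ^ 3 - a ^ 2 + 5 * a - 2) : 𝓞 KD) = -(4 * a ^ 2 + 25) by
        linear_combination (a ^ 2 + 3 : 𝓞 KD) * ra_int_quartic hs ha,
      Ideal.span_singleton_neg]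
  have hNc2 : Ideal.absNorm (Ideal.span {(a ^ 3 - a ^ 2 + 5 * a - 2 : 𝓞 KD)}) =
      Ideal.absNorm (Ideal.span {(a ^ 3 + a ^ 2 + 5 * a + 2 : 𝓞 KD)}) := by
    rw [← absNorm_span_conj (a ^ 3 + a ^ 2 + 5 * a + 2), hconj2, Ideal.span_singleton_neg]
  have hNx2 : Ideal.absNorm (Ideal.span {(a ^ 3 + a ^ 2 + 5 * a + 2 : 𝓞 KD)}) = 137 := by
    have h := congrArg Ideal.absNorm hxx2
    rw [map_mul, hNc2, hDD, hNDD] at h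
    have h' : Ideal.absNorm (Ideal.span {(a ^ 3 + a ^ 2 + 5 * a + 2 : 𝓞 KD)}) ^ 2 = 137 ^ 2 := by rw [sq, h]
    exact Nat.pow_left_injective two_ne_zero h'
  have hNx2' : Ideal.absNorm (Ideal.span {(a ^ 3 - a ^ 2 + 5 * a - 2 : 𝓞 KD)}) = 137 := by rw [hNc2, hNx2]
  have h3 : Ideal.span {(a ^ 3 + a ^ 2 + 5 * a + 2 : 𝓞 KD)} = Ideal.span {(137 : 𝓞 KD), a - 24} :=
    key (by rw [Ideal.span_singleton_le_iff_mem]; exact Ideal.mem_span_pair.mpr ⟨106, a ^ 2 + 25 * a + 605, by ring⟩)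
      (by rw [hNx2, hN3]) (by rw [hN3]; norm_num)
  have h4 : Ideal.span {(a ^ 3 - a ^ 2 + 5 * a - 2 : 𝓞 KD)} = Ideal.span {(137 : 𝓞 KD), a + 24} :=
    key (by rw [Ideal.span_singleton_le_iff_mem]; exact Ideal.mem_span_pair.mpr ⟨-106, a ^ 2 - 25 * a + 605, by ring⟩)
      (by rw [hNx2', hN4]) (by rw [hN4]; norm_num)
  exact ⟨h1.symm, h2.symm, h3.symm, h4.symm, ⟨⟨_, h1.symm⟩⟩, ⟨⟨_, h2.symm⟩⟩, ⟨⟨_, h3.symm⟩⟩, ⟨⟨_, h4.symm⟩⟩⟩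

end ClassesOneThirtySeven

/-! ### §3. `193`: a prime that splits completely into four NON-principal primes:
`(a³ + 6a + 1) = 𝔓₂·(193, a − 7)`, `(3a² − a + 8) = 𝔓₂·(193, a − 36)`

`r = 141` (`141² ≡ 2`), `36² ≡ r − 3`, `7² ≡ −(r + 3)`; `x = a³ + 6a + 1` has `x x̄ = 7a² + 43 = (a² + 3)(11a² + 40)` with
`11a² + 40 = 11(a² + 144) − 8·193`, and `x′ = 3a² − a + 8` has `x′ x̄′ = 1 − 7a² = (a² + 3)(11a² + 26)` with `11a² + 26 = 11(a² − 138) + 8·193`;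
`(7a² + 43)(1 − 7a²) = 386 − 49(a⁴ + 6a² + 7)`, so `(7a² + 43) = 𝔓₂²(193, a − 7)(193, a + 7)`, `(1 − 7a²) = 𝔓₂²(193, a − 36)(193, a + 36)`
and `‖(x)‖ = ‖(x′)‖ = 386 = 2·193`. -/

section ClassesOneNinetyThree

variable {s : 𝓞 (maximalRealSubfield KD)} (hs : ((s : maximalRealSubfield KD) : KD) = rs)
variable {a : 𝓞 KD} (ha : (a : KD) = ra)
variable (w₂ : HeightOneSpectrum (𝓞 KD)) [h₂ : w₂.asIdeal.LiesOver (Ideal.span {s})]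
include hs

/-- **`193𝓞_K = (193, a − 36)(193, a + 36)(193, a − 7)(193, a + 7)`** with `(7a² + 43) = 𝔓₂²·(193, a − 7)(193, a + 7)`,
`(1 − 7a²) = 𝔓₂²·(193, a − 36)(193, a + 36)`, `(a³ + 6a + 1) = 𝔓₂·(193, a − 7)` and `(3a² − a + 8) = 𝔓₂·(193, a − 36)`
(both of norm `386`). [cite: Marcus2018, Ch. 3 Thm 27] [cite: Marcus2018, Ch. 5, discussion after Thm 37] -/
theorem span_oneNinetyThree_factors (ha : (a : KD) = ra) :
    Ideal.span {(193 : 𝓞 KD)} =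
      Ideal.span {(193 : 𝓞 KD), a - 36} * Ideal.span {(193 : 𝓞 KD), a + 36} *
        (Ideal.span {(193 : 𝓞 KD), a - 7} * Ideal.span {(193 : 𝓞 KD), a + 7}) ∧
      Ideal.span {(7 * a ^ 2 + 43 : 𝓞 KD)} = w₂.asIdeal ^ 2 * (Ideal.span {(193 : 𝓞 KD), a - 7} * Ideal.span {(193 : 𝓞 KD), a + 7}) ∧
      Ideal.span {(1 - 7 * a ^ 2 : 𝓞 KD)} = w₂.asIdeal ^ 2 * (Ideal.span {(193 : 𝓞 KD), a - 36} * Ideal.span {(193 : 𝓞 KD), a + 36}) ∧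
      Ideal.span {(a ^ 3 + 6 * a + 1 : 𝓞 KD)} = w₂.asIdeal * Ideal.span {(193 : 𝓞 KD), a - 7} ∧
      Ideal.span {(3 * a ^ 2 - a + 8 : 𝓞 KD)} = w₂.asIdeal * Ideal.span {(193 : 𝓞 KD), a - 36} := by
  obtain ⟨h, h1, h2, h3, h4⟩ := span_natCast_eq_mul_four ha (p := 193) (by norm_num) (r := 141) (c := 36) (d := 7)
    (by decide) (by decide) (by decide)
  obtain ⟨hCC, hDD, -⟩ := span_sub_mul_span_add_eq_four ha (p := 193) (by norm_num) (r := 141) (c := 36) (d := 7)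
    (by decide) (by decide) (by decide)
  obtain ⟨hs3, hN2⟩ := span_sq_add_three_eq hs w₂ ha
  have e1 : (a ^ 2 + 3 - ((141 : ℤ) : 𝓞 KD)) = a ^ 2 - 138 := by push_cast; ring
  have e2 : (a ^ 2 + 3 + ((141 : ℤ) : 𝓞 KD)) = a ^ 2 + 144 := by push_cast; ring
  rw [e1] at hCC
  rw [e2] at hDD
  simp only [Nat.cast_ofNat, Int.cast_ofNat] at h h1 h2 h3 h4 hCC hDD
  have hNCC : Ideal.absNorm (Ideal.span {(193 : 𝓞 KD), a - 36} * Ideal.span {(193 : 𝓞 KD), a + 36}) = 193 ^ 2 := by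
    rw [map_mul, h1.2, h2.2]; ring
  have hNDD : Ideal.absNorm (Ideal.span {(193 : 𝓞 KD), a - 7} * Ideal.span {(193 : 𝓞 KD), a + 7}) = 193 ^ 2 := by
    rw [map_mul, h3.2, h4.2]; ring
  have hNw2 : Ideal.absNorm (w₂.asIdeal ^ 2) = 4 := by rw [map_pow, hN2]; norm_num
  have f1 : (7 * a ^ 2 + 43 : 𝓞 KD) = (a ^ 2 + 3) * (11 * a ^ 2 + 40) := by
    linear_combination (-11 : 𝓞 KD) * ra_int_quartic hs ha
  have f2 : (1 - 7 * a ^ 2 : 𝓞 KD) = (a ^ 2 + 3) * (11 * a ^ 2 + 26) := by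
    linear_combination (-11 : 𝓞 KD) * ra_int_quartic hs ha
  have hY : Ideal.span {(7 * a ^ 2 + 43 : 𝓞 KD)} ≤ w₂.asIdeal ^ 2 * (Ideal.span {(193 : 𝓞 KD), a - 7} * Ideal.span {(193 : 𝓞 KD), a + 7}) := by
    rw [← hs3, hDD, Ideal.span_singleton_le_iff_mem]
    have hmem : (a ^ 2 + 3) * (11 * a ^ 2 + 40) ∈ Ideal.span {(a ^ 2 + 3 : 𝓞 KD)} * Ideal.span {(193 : 𝓞 KD), a ^ 2 + 144} :=
      Ideal.mul_mem_mul (Ideal.mem_span_singleton_self _) (Ideal.mem_span_pair.mpr ⟨-8, 11, by ring⟩)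
    rwa [← f1] at hmem
  have hZ : Ideal.span {(1 - 7 * a ^ 2 : 𝓞 KD)} ≤ w₂.asIdeal ^ 2 * (Ideal.span {(193 : 𝓞 KD), a - 36} * Ideal.span {(193 : 𝓞 KD), a + 36}) := by
    rw [← hs3, hCC, Ideal.span_singleton_le_iff_mem]
    have hmem : (a ^ 2 + 3) * (11 * a ^ 2 + 26) ∈ Ideal.span {(a ^ 2 + 3 : 𝓞 KD)} * Ideal.span {(193 : 𝓞 KD), a ^ 2 - 138} :=
      Ideal.mul_mem_mul (Ideal.mem_span_singleton_self _) (Ideal.mem_span_pair.mpr ⟨8, 11, by ring⟩)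
    rwa [← f2] at hmem
  have hprod : Ideal.span {(7 * a ^ 2 + 43 : 𝓞 KD)} * Ideal.span {(1 - 7 * a ^ 2 : 𝓞 KD)} = Ideal.span {((386 : ℕ) : 𝓞 KD)} := by
    rw [Ideal.span_singleton_mul_span_singleton, Nat.cast_ofNat,
      show ((7 * a ^ 2 + 43) * (1 - 7 * a ^ 2) : 𝓞 KD) = 386 by linear_combination (-49 : 𝓞 KD) * ra_int_quartic hs ha]
  have hNA : Ideal.absNorm (w₂.asIdeal ^ 2 * (Ideal.span {(193 : 𝓞 KD), a - 7} * Ideal.span {(193 : 𝓞 KD), a + 7})) =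
      4 * 193 ^ 2 := by
    rw [map_mul, hNw2, hNDD]
  have hNB : Ideal.absNorm (w₂.asIdeal ^ 2 * (Ideal.span {(193 : 𝓞 KD), a - 36} * Ideal.span {(193 : 𝓞 KD), a + 36})) =
      4 * 193 ^ 2 := by
    rw [map_mul, hNw2, hNCC]
  have hN : Ideal.absNorm (Ideal.span {(7 * a ^ 2 + 43 : 𝓞 KD)}) * Ideal.absNorm (Ideal.span {(1 - 7 * a ^ 2 : 𝓞 KD)}) =
      Ideal.absNorm (w₂.asIdeal ^ 2 * (Ideal.span {(193 : 𝓞 KD), a - 7} * Ideal.span {(193 : 𝓞 KD), a + 7})) *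
        Ideal.absNorm (w₂.asIdeal ^ 2 * (Ideal.span {(193 : 𝓞 KD), a - 36} * Ideal.span {(193 : 𝓞 KD), a + 36})) := by
    rw [← map_mul, hprod, absNorm_span_natCast, hNA, hNB]; norm_num
  obtain ⟨hA, hB⟩ := eq_and_eq_of_le_of_absNorm hY hZ hN (by rw [hNA]; norm_num) (by rw [hNB]; norm_num)
  -- norms of `x = a³ + 6a + 1` and `x′ = 3a² − a + 8`
  have hconj1 : ringOfIntegersComplexConj KD (a ^ 3 + 6 * a + 1) = -(a ^ 3 + 6 * a - 1) := by
    rw [map_add, map_add, map_pow, map_mul, conj_ra_int ha, map_ofNat, map_one]; ring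
  have hxx1 : Ideal.span {(a ^ 3 + 6 * a + 1 : 𝓞 KD)} * Ideal.span {(a ^ 3 + 6 * a - 1 : 𝓞 KD)} =
      Ideal.span {(7 * a ^ 2 + 43 : 𝓞 KD)} := by
    rw [Ideal.span_singleton_mul_span_singleton,
      show ((a ^ 3 + 6 * a + 1) * (a ^ 3 + 6 * a - 1) : 𝓞 KD) = -(7 * a ^ 2 + 43) by
        linear_combination (a ^ 2 + 6 : 𝓞 KD) * ra_int_quartic hs ha,
      Ideal.span_singleton_neg]
  have hsp1 : Ideal.span {(a ^ 3 + 6 * a - 1 : 𝓞 KD)} = Ideal.span {ringOfIntegersComplexConj KD (a ^ 3 + 6 * a + 1)} := by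
    rw [hconj1, Ideal.span_singleton_neg]
  have hNx1 : Ideal.absNorm (Ideal.span {(a ^ 3 + 6 * a + 1 : 𝓞 KD)}) = 386 := by
    have h := congrArg Ideal.absNorm hxx1
    rw [map_mul, hsp1, absNorm_span_conj, hA, hNA] at h
    have h' : Ideal.absNorm (Ideal.span {(a ^ 3 + 6 * a + 1 : 𝓞 KD)}) ^ 2 = 386 ^ 2 := by rw [sq, h]; norm_num
    exact Nat.pow_left_injective two_ne_zero h'
  have hconj2 : ringOfIntegersComplexConj KD (3 * a ^ 2 - a + 8) = 3 * a ^ 2 + a + 8 := by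
    rw [map_add, map_sub, map_mul, map_pow, conj_ra_int ha, map_ofNat, map_ofNat]; ring
  have hxx2 : Ideal.span {(3 * a ^ 2 - a + 8 : 𝓞 KD)} * Ideal.span {(3 * a ^ 2 + a + 8 : 𝓞 KD)} =
      Ideal.span {(1 - 7 * a ^ 2 : 𝓞 KD)} := by
    rw [Ideal.span_singleton_mul_span_singleton,
      show ((3 * a ^ 2 - a + 8) * (3 * a ^ 2 + a + 8) : 𝓞 KD) = 1 - 7 * a ^ 2 by
        linear_combination (9 : 𝓞 KD) * ra_int_quartic hs ha]
  have hNx2 : Ideal.absNorm (Ideal.span {(3 * a ^ 2 - a + 8 : 𝓞 KD)}) = 386 := by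
    have h := congrArg Ideal.absNorm hxx2
    rw [map_mul, ← hconj2, absNorm_span_conj, hB, hNB] at h
    have h' : Ideal.absNorm (Ideal.span {(3 * a ^ 2 - a + 8 : 𝓞 KD)}) ^ 2 = 386 ^ 2 := by rw [sq, h]; norm_num
    exact Nat.pow_left_injective two_ne_zero h'
  haveI := h1.1; haveI := h3.1
  have hw := w₂_eq_span_pair hs w₂ ha
  refine ⟨h, hA, hB, ?_, ?_⟩
  · refine span_eq_w₂_mul_of_mem hs w₂ (by intro h0; rw [h0, Ideal.absNorm_bot] at h3; norm_num at h3)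
      (by intro h0; rw [h0, hN2] at h3; norm_num at h3) (Ideal.mem_span_pair.mpr ⟨2, a ^ 2 + 7 * a + 55, by ring⟩) ?_
      (by norm_num [hNx1, h3.2])
    rw [hw]; exact Ideal.mem_span_pair.mpr ⟨4, a ^ 2 + a + 7, by ring⟩
  · refine span_eq_w₂_mul_of_mem hs w₂ (by intro h0; rw [h0, Ideal.absNorm_bot] at h1; norm_num at h1)
      (by intro h0; rw [h0, hN2] at h1; norm_num at h1) (Ideal.mem_span_pair.mpr ⟨20, 3 * a + 107, by ring⟩) ?_
      (by norm_num [hNx2, h1.2])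
    rw [hw]; exact Ideal.mem_span_pair.mpr ⟨5, 3 * a + 2, by ring⟩

omit h₂ in
/-- **All four primes above `193` are NON-principal** (class `[𝔓₂]`): compare `137` (§2), where all four are principal.
[cite: Marcus2018, Ch. 5, discussion after Thm 37] -/
theorem not_isPrincipal_span_oneNinetyThree (ha : (a : KD) = ra) :
    ¬ (Ideal.span {(193 : 𝓞 KD), a - 36}).IsPrincipal ∧ ¬ (Ideal.span {(193 : 𝓞 KD), a + 36}).IsPrincipal ∧
      ¬ (Ideal.span {(193 : 𝓞 KD), a - 7}).IsPrincipal ∧ ¬ (Ideal.span {(193 : 𝓞 KD), a + 7}).IsPrincipal := by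
  obtain ⟨w, hw, -⟩ := exists_prime_two' hs
  haveI := hw
  obtain ⟨-, -, -, hx1, hx2⟩ := span_oneNinetyThree_factors hs w ha
  have hP0 : ∀ t : 𝓞 KD, Ideal.span {(193 : 𝓞 KD), t} ≠ ⊥ := by
    intro t h0
    have h193 : (193 : 𝓞 KD) ∈ Ideal.span {(193 : 𝓞 KD), t} := Ideal.subset_span (by simp)
    rw [h0, Ideal.mem_bot] at h193
    have h := congrArg (fun z : 𝓞 KD => (z : KD)) h193
    push_cast at h
    norm_num at h
  have hz1 : (a ^ 3 + 6 * a + 1 : 𝓞 KD) ≠ 0 := by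
    intro h0
    rw [h0, Ideal.span_singleton_eq_bot.mpr rfl, eq_comm, Ideal.mul_eq_bot] at hx1
    exact hx1.elim w.ne_bot (hP0 _)
  have hz2 : (3 * a ^ 2 - a + 8 : 𝓞 KD) ≠ 0 := by
    intro h0
    rw [h0, Ideal.span_singleton_eq_bot.mpr rfl, eq_comm, Ideal.mul_eq_bot] at hx2
    exact hx2.elim w.ne_bot (hP0 _)
  have n7 : ¬ (Ideal.span {(193 : 𝓞 KD), a - 7}).IsPrincipal :=
    fun h => not_isPrincipal_w₂ hs w ((isPrincipal_iff_of_mul_eq_span hx1.symm hz1).mpr h)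
  have n36 : ¬ (Ideal.span {(193 : 𝓞 KD), a - 36}).IsPrincipal :=
    fun h => not_isPrincipal_w₂ hs w ((isPrincipal_iff_of_mul_eq_span hx2.symm hz2).mpr h)
  have hiff := isPrincipal_span_pair_sub_iff_four hs ha (p := 193) (by norm_num) (r := 141) (c := 36) (d := 7)
    (by decide) (by decide) (by decide)
  simp only [Nat.cast_ofNat, Int.cast_ofNat] at hiff
  exact ⟨n36, fun h => n36 (hiff.1.mpr h), n7, fun h => n7 (hiff.2.mpr h)⟩

end ClassesOneNinetyThree

/-! ### §4. Degree-two primes: both primes above `19` are NOT principal, both primes above `29` ARE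
(`19 = (19, a² + 4a + 11)(19, a² − 4a + 11)`, `29 = (29, a² + 8a + 6)(29, a² − 8a + 6)`, shape `𝔓𝔓′` of
`NonGaloisQuarticCMFieldPrimeDecomposition` §7)

`19`: `x = 2a³ + a² + 5a + 4` has `x·(2a³ − a² + 5a − 4) = 19(a² + 1)` and `(a² + 1) = (a² + 3) = 𝔓₂²` (`a² + 1 = −(a² + 2)(a² + 3)`,
`(a² + 2)(a² + 4) = 1`), so `‖(x)‖ = 2·19²` and `(x) = 𝔓₂·(19, a² − 4a + 11)`.  `29`: `x = a³ + 3a² + 5a + 8` has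
`x·(a³ − 3a² + 5a − 8) = −29`, so `‖(x)‖ = 29²` and `(29, a² − 8a + 6) = (x)`. -/

section ClassesNineteenTwentyNine

variable {s : 𝓞 (maximalRealSubfield KD)} (hs : ((s : maximalRealSubfield KD) : KD) = rs)
variable {a : 𝓞 KD} (ha : (a : KD) = ra)
variable (w₂ : HeightOneSpectrum (𝓞 KD)) [h₂ : w₂.asIdeal.LiesOver (Ideal.span {s})]
include hs

/-- `(a² + 1) = 𝔓₂²`: `a² + 1 = −(a² + 2)(a² + 3)` with `−(a² + 2) = 1 + √2` a unit (`(a² + 2)(a² + 4) = 1`). [folklore] -/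
private theorem span_sq_add_one_eq (ha : (a : KD) = ra) : Ideal.span {(a ^ 2 + 1 : 𝓞 KD)} = w₂.asIdeal ^ 2 := by
  obtain ⟨hs3, -⟩ := span_sq_add_three_eq hs w₂ ha
  rw [← hs3, Ideal.span_singleton_eq_span_singleton]
  refine ⟨Units.mkOfMulEqOne (-(a ^ 2 + 4)) (-(a ^ 2 + 2)) (by linear_combination ra_int_quartic hs ha), ?_⟩
  rw [Units.val_mkOfMulEqOne]
  linear_combination (-1 : 𝓞 KD) * ra_int_quartic hs ha

/-- **`(2a³ + a² + 5a + 4) = 𝔓₂·(19, a² − 4a + 11)` and `(2a³ − a² + 5a − 4) = 𝔓₂·(19, a² + 4a + 11)`**, both elements of norm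
`722 = 2·19²` (`2a³ + a² + 5a + 4 = 19(a − 5) + (a² − 4a + 11)(2a + 9) = 12 + (a − 1)(2a² + 3a + 8)`).
[cite: Marcus2018, Ch. 5, discussion after Thm 37] -/
theorem span_x19_eq (ha : (a : KD) = ra) :
    Ideal.span {(2 * a ^ 3 + a ^ 2 + 5 * a + 4 : 𝓞 KD)} = w₂.asIdeal * Ideal.span {(19 : 𝓞 KD), a ^ 2 - 4 * a + 11} ∧
      Ideal.span {(2 * a ^ 3 - a ^ 2 + 5 * a - 4 : 𝓞 KD)} = w₂.asIdeal * Ideal.span {(19 : 𝓞 KD), a ^ 2 + 4 * a + 11} ∧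
      Ideal.absNorm (Ideal.span {(2 * a ^ 3 + a ^ 2 + 5 * a + 4 : 𝓞 KD)}) = 722 ∧
      Ideal.absNorm (Ideal.span {(2 * a ^ 3 - a ^ 2 + 5 * a - 4 : 𝓞 KD)}) = 722 := by
  obtain ⟨-, h1, h2, -⟩ := span_natCast_eq_mul_two' ha (p := 19) (by norm_num) (by norm_num) (u := 4) (v := 11)
    (by decide) (by decide) (by decide)
  have e : (a ^ 2 + -((4 : ℤ) : 𝓞 KD) * a + ((11 : ℤ) : 𝓞 KD)) = a ^ 2 - 4 * a + 11 := by push_cast; ring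
  rw [e] at h2
  simp only [Nat.cast_ofNat, Int.cast_ofNat] at h1 h2
  obtain ⟨-, hN2⟩ := span_sq_add_three_eq hs w₂ ha
  have hs1 := span_sq_add_one_eq hs w₂ ha
  have hNw2 : Ideal.absNorm (w₂.asIdeal ^ 2) = 4 := by rw [map_pow, hN2]; norm_num
  have hconj : ringOfIntegersComplexConj KD (2 * a ^ 3 + a ^ 2 + 5 * a + 4) = -(2 * a ^ 3 - a ^ 2 + 5 * a - 4) := by
    rw [map_add, map_add, map_add, map_mul, map_pow, map_pow, map_mul, conj_ra_int ha, map_ofNat, map_ofNat, map_ofNat]; ring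
  have hxx : Ideal.span {(2 * a ^ 3 + a ^ 2 + 5 * a + 4 : 𝓞 KD)} * Ideal.span {(2 * a ^ 3 - a ^ 2 + 5 * a - 4 : 𝓞 KD)} =
      Ideal.span {((19 : ℕ) : 𝓞 KD)} * Ideal.span {(a ^ 2 + 1 : 𝓞 KD)} := by
    rw [Ideal.span_singleton_mul_span_singleton, Ideal.span_singleton_mul_span_singleton, Nat.cast_ofNat,
      show ((2 * a ^ 3 + a ^ 2 + 5 * a + 4) * (2 * a ^ 3 - a ^ 2 + 5 * a - 4) : 𝓞 KD) = 19 * (a ^ 2 + 1) by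
        linear_combination (4 * a ^ 2 - 5 : 𝓞 KD) * ra_int_quartic hs ha]
  have hNc : Ideal.absNorm (Ideal.span {(2 * a ^ 3 - a ^ 2 + 5 * a - 4 : 𝓞 KD)}) =
      Ideal.absNorm (Ideal.span {(2 * a ^ 3 + a ^ 2 + 5 * a + 4 : 𝓞 KD)}) := by
    rw [← absNorm_span_conj (2 * a ^ 3 + a ^ 2 + 5 * a + 4), hconj, Ideal.span_singleton_neg]
  have hNx : Ideal.absNorm (Ideal.span {(2 * a ^ 3 + a ^ 2 + 5 * a + 4 : 𝓞 KD)}) = 722 := by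
    have h := congrArg Ideal.absNorm hxx
    rw [map_mul, map_mul, hNc, absNorm_span_natCast, hs1, hNw2] at h
    have h' : Ideal.absNorm (Ideal.span {(2 * a ^ 3 + a ^ 2 + 5 * a + 4 : 𝓞 KD)}) ^ 2 = 722 ^ 2 := by rw [sq, h]; norm_num
    exact Nat.pow_left_injective two_ne_zero h'
  have hNx' : Ideal.absNorm (Ideal.span {(2 * a ^ 3 - a ^ 2 + 5 * a - 4 : 𝓞 KD)}) = 722 := by rw [hNc, hNx]
  haveI := h1.1; haveI := h2.1
  have hw := w₂_eq_span_pair hs w₂ ha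
  refine ⟨?_, ?_, hNx, hNx'⟩
  · refine span_eq_w₂_mul_of_mem hs w₂ (by intro h0; rw [h0, Ideal.absNorm_bot] at h2; norm_num at h2)
      (by intro h0; rw [h0, hN2] at h2; norm_num at h2) (Ideal.mem_span_pair.mpr ⟨a - 5, 2 * a + 9, by ring⟩) ?_
      (by norm_num [hNx, h2.2])
    rw [hw]; exact Ideal.mem_span_pair.mpr ⟨6, 2 * a ^ 2 + 3 * a + 8, by ring⟩
  · refine span_eq_w₂_mul_of_mem hs w₂ (by intro h0; rw [h0, Ideal.absNorm_bot] at h1; norm_num at h1)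
      (by intro h0; rw [h0, hN2] at h1; norm_num at h1) (Ideal.mem_span_pair.mpr ⟨a + 5, 2 * a - 9, by ring⟩) ?_
      (by norm_num [hNx', h1.2])
    rw [hw]; exact Ideal.mem_span_pair.mpr ⟨1, 2 * a ^ 2 + a + 6, by ring⟩

omit h₂ in
/-- **Neither prime above `19` is principal**: `19𝓞_K = 𝔓𝔓′` with `𝔓, 𝔓′ ∈ [𝔓₂]` (the first degree-two example).
[cite: Marcus2018, Ch. 5, discussion after Thm 37] -/
theorem not_isPrincipal_span_nineteen (ha : (a : KD) = ra) :
    ¬ (Ideal.span {(19 : 𝓞 KD), a ^ 2 + 4 * a + 11}).IsPrincipal ∧ ¬ (Ideal.span {(19 : 𝓞 KD), a ^ 2 - 4 * a + 11}).IsPrincipal := by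
  obtain ⟨w, hw, -⟩ := exists_prime_two' hs
  haveI := hw
  obtain ⟨hx1, hx2, -, -⟩ := span_x19_eq hs w ha
  have hP0 : ∀ t : 𝓞 KD, Ideal.span {(19 : 𝓞 KD), t} ≠ ⊥ := by
    intro t h0
    have h19 : (19 : 𝓞 KD) ∈ Ideal.span {(19 : 𝓞 KD), t} := Ideal.subset_span (by simp)
    rw [h0, Ideal.mem_bot] at h19
    have h := congrArg (fun z : 𝓞 KD => (z : KD)) h19
    push_cast at h
    norm_num at h
  have hz1 : (2 * a ^ 3 + a ^ 2 + 5 * a + 4 : 𝓞 KD) ≠ 0 := by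
    intro h0
    rw [h0, Ideal.span_singleton_eq_bot.mpr rfl, eq_comm, Ideal.mul_eq_bot] at hx1
    exact hx1.elim w.ne_bot (hP0 _)
  have hz2 : (2 * a ^ 3 - a ^ 2 + 5 * a - 4 : 𝓞 KD) ≠ 0 := by
    intro h0
    rw [h0, Ideal.span_singleton_eq_bot.mpr rfl, eq_comm, Ideal.mul_eq_bot] at hx2
    exact hx2.elim w.ne_bot (hP0 _)
  exact ⟨fun h => not_isPrincipal_w₂ hs w ((isPrincipal_iff_of_mul_eq_span hx2.symm hz2).mpr h),
    fun h => not_isPrincipal_w₂ hs w ((isPrincipal_iff_of_mul_eq_span hx1.symm hz1).mpr h)⟩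

omit h₂ in
/-- **`29𝓞_K = (29, a² + 8a + 6)(29, a² − 8a + 6)` with BOTH primes principal: `(29, a² − 8a + 6) = (a³ + 3a² + 5a + 8)`,
`(29, a² + 8a + 6) = (a³ − 3a² + 5a − 8)`** (`(a³ + 3a² + 5a + 8)(a³ − 3a² + 5a − 8) = −29`;
`a³ + 3a² + 5a + 8 = 29(3a − 2) + (a² − 8a + 6)(a + 11)`). [cite: Marcus2018, Ch. 3 Thm 27]
[cite: Marcus2018, Ch. 5, discussion after Thm 37] -/
theorem span_twentyNine_eq (ha : (a : KD) = ra) :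
    Ideal.span {(29 : 𝓞 KD)} = Ideal.span {(29 : 𝓞 KD), a ^ 2 + 8 * a + 6} * Ideal.span {(29 : 𝓞 KD), a ^ 2 - 8 * a + 6} ∧
      Ideal.span {(29 : 𝓞 KD), a ^ 2 - 8 * a + 6} = Ideal.span {(a ^ 3 + 3 * a ^ 2 + 5 * a + 8 : 𝓞 KD)} ∧
      Ideal.span {(29 : 𝓞 KD), a ^ 2 + 8 * a + 6} = Ideal.span {(a ^ 3 - 3 * a ^ 2 + 5 * a - 8 : 𝓞 KD)} ∧
      (Ideal.span {(29 : 𝓞 KD), a ^ 2 + 8 * a + 6}).IsPrincipal ∧ (Ideal.span {(29 : 𝓞 KD), a ^ 2 - 8 * a + 6}).IsPrincipal := by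
  obtain ⟨h, h1, h2, -⟩ := span_natCast_eq_mul_two' ha (p := 29) (by norm_num) (by norm_num) (u := 8) (v := 6)
    (by decide) (by decide) (by decide)
  have e : (a ^ 2 + -((8 : ℤ) : 𝓞 KD) * a + ((6 : ℤ) : 𝓞 KD)) = a ^ 2 - 8 * a + 6 := by push_cast; ring
  rw [e] at h h2
  simp only [Nat.cast_ofNat, Int.cast_ofNat] at h h1 h2
  have hconj : ringOfIntegersComplexConj KD (a ^ 3 + 3 * a ^ 2 + 5 * a + 8) = -(a ^ 3 - 3 * a ^ 2 + 5 * a - 8) := by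
    rw [map_add, map_add, map_add, map_pow, map_mul, map_pow, map_mul, conj_ra_int ha, map_ofNat, map_ofNat, map_ofNat]; ring
  have hxx : Ideal.span {(a ^ 3 + 3 * a ^ 2 + 5 * a + 8 : 𝓞 KD)} * Ideal.span {(a ^ 3 - 3 * a ^ 2 + 5 * a - 8 : 𝓞 KD)} =
      Ideal.span {((29 : ℕ) : 𝓞 KD)} := by
    rw [Ideal.span_singleton_mul_span_singleton, Nat.cast_ofNat,
      show ((a ^ 3 + 3 * a ^ 2 + 5 * a + 8) * (a ^ 3 - 3 * a ^ 2 + 5 * a - 8) : 𝓞 KD) = -29 by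
        linear_combination (a ^ 2 - 5 : 𝓞 KD) * ra_int_quartic hs ha,
      Ideal.span_singleton_neg]
  have hNc : Ideal.absNorm (Ideal.span {(a ^ 3 - 3 * a ^ 2 + 5 * a - 8 : 𝓞 KD)}) =
      Ideal.absNorm (Ideal.span {(a ^ 3 + 3 * a ^ 2 + 5 * a + 8 : 𝓞 KD)}) := by
    rw [← absNorm_span_conj (a ^ 3 + 3 * a ^ 2 + 5 * a + 8), hconj, Ideal.span_singleton_neg]
  have hNx : Ideal.absNorm (Ideal.span {(a ^ 3 + 3 * a ^ 2 + 5 * a + 8 : 𝓞 KD)}) = 29 ^ 2 := by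
    have h := congrArg Ideal.absNorm hxx
    rw [map_mul, hNc, absNorm_span_natCast] at h
    have h' : Ideal.absNorm (Ideal.span {(a ^ 3 + 3 * a ^ 2 + 5 * a + 8 : 𝓞 KD)}) ^ 2 = (29 ^ 2) ^ 2 := by rw [sq, h]; norm_num
    exact Nat.pow_left_injective two_ne_zero h'
  have hNx' : Ideal.absNorm (Ideal.span {(a ^ 3 - 3 * a ^ 2 + 5 * a - 8 : 𝓞 KD)}) = 29 ^ 2 := by rw [hNc, hNx]
  have key : ∀ {I J : Ideal (𝓞 KD)}, I ≤ J → Ideal.absNorm I = Ideal.absNorm J → Ideal.absNorm J ≠ 0 → I = J := by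
    intro I J hle hIJ hJ
    exact (eq_and_eq_of_le_of_absNorm hle hle (by rw [hIJ]) hJ hJ).1
  have hA : Ideal.span {(a ^ 3 + 3 * a ^ 2 + 5 * a + 8 : 𝓞 KD)} = Ideal.span {(29 : 𝓞 KD), a ^ 2 - 8 * a + 6} :=
    key (by rw [Ideal.span_singleton_le_iff_mem]; exact Ideal.mem_span_pair.mpr ⟨3 * a - 2, a + 11, by ring⟩)
      (by rw [hNx, h2.2]) (by rw [h2.2]; norm_num)
  have hB : Ideal.span {(a ^ 3 - 3 * a ^ 2 + 5 * a - 8 : 𝓞 KD)} = Ideal.span {(29 : 𝓞 KD), a ^ 2 + 8 * a + 6} :=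
    key (by rw [Ideal.span_singleton_le_iff_mem]; exact Ideal.mem_span_pair.mpr ⟨3 * a + 2, a - 11, by ring⟩)
      (by rw [hNx', h1.2]) (by rw [h1.2]; norm_num)
  exact ⟨h, hA.symm, hB.symm, ⟨⟨_, hB.symm⟩⟩, ⟨⟨_, hA.symm⟩⟩⟩

end ClassesNineteenTwentyNine

/-! ### §5. Degree-two primes, continued: both primes above `37` are principal, both above `59` are NOT
(`37 = (37, a² + 7a + 9)(37, a² − 7a + 9)`, `59 = (59, a² + 29a − 19)(59, a² − 29a − 19)`)

`37`: `(2a³ − 2a² + 8a − 3)(2a³ + 2a² + 8a + 3) = −37`.  `59`: `x = 4a³ + a² + 11a + 2` has `x·(4a³ − a² + 11a − 2) = 59(a² + 1)`,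
`(a² + 1) = 𝔓₂²`, so `‖(x)‖ = 2·59²` and `(x) = 𝔓₂·(59, a² + 29a − 19)`. -/

section ClassesThirtySevenFiftyNine

variable {s : 𝓞 (maximalRealSubfield KD)} (hs : ((s : maximalRealSubfield KD) : KD) = rs)
variable {a : 𝓞 KD} (ha : (a : KD) = ra)
variable (w₂ : HeightOneSpectrum (𝓞 KD)) [h₂ : w₂.asIdeal.LiesOver (Ideal.span {s})]
include hs

omit h₂ in
/-- **`37𝓞_K = (37, a² + 7a + 9)(37, a² − 7a + 9)` with BOTH primes principal: `(37, a² − 7a + 9) = (2a³ − 2a² + 8a − 3)`,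
`(37, a² + 7a + 9) = (2a³ + 2a² + 8a + 3)`** (`v ≡ 9`, `u ≡ 7`: `81 ≡ 7`, `49 ≡ 12 = 2v − 6`, `−24` a non-residue mod `37`;
`(2a³ − 2a² + 8a − 3)(2a³ + 2a² + 8a + 3) = −37`; `2a³ − 2a² + 8a − 3 = 37(2a − 3) + (a² − 7a + 9)(2a + 12)`).
[cite: Marcus2018, Ch. 3 Thm 27] [cite: Marcus2018, Ch. 5, discussion after Thm 37] -/
theorem span_thirtySeven_eq (ha : (a : KD) = ra) :
    Ideal.span {(37 : 𝓞 KD)} = Ideal.span {(37 : 𝓞 KD), a ^ 2 + 7 * a + 9} * Ideal.span {(37 : 𝓞 KD), a ^ 2 - 7 * a + 9} ∧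
      Ideal.span {(37 : 𝓞 KD), a ^ 2 - 7 * a + 9} = Ideal.span {(2 * a ^ 3 - 2 * a ^ 2 + 8 * a - 3 : 𝓞 KD)} ∧
      Ideal.span {(37 : 𝓞 KD), a ^ 2 + 7 * a + 9} = Ideal.span {(2 * a ^ 3 + 2 * a ^ 2 + 8 * a + 3 : 𝓞 KD)} ∧
      (Ideal.span {(37 : 𝓞 KD), a ^ 2 + 7 * a + 9}).IsPrincipal ∧ (Ideal.span {(37 : 𝓞 KD), a ^ 2 - 7 * a + 9}).IsPrincipal := by
  obtain ⟨h, h1, h2, -⟩ := span_natCast_eq_mul_two' ha (p := 37) (by norm_num) (by norm_num) (u := 7) (v := 9)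
    (by decide) (by decide) (by decide)
  have e : (a ^ 2 + -((7 : ℤ) : 𝓞 KD) * a + ((9 : ℤ) : 𝓞 KD)) = a ^ 2 - 7 * a + 9 := by push_cast; ring
  rw [e] at h h2
  simp only [Nat.cast_ofNat, Int.cast_ofNat] at h h1 h2
  have hconj : ringOfIntegersComplexConj KD (2 * a ^ 3 - 2 * a ^ 2 + 8 * a - 3) = -(2 * a ^ 3 + 2 * a ^ 2 + 8 * a + 3) := by
    rw [map_sub, map_add, map_sub, map_mul, map_pow, map_mul, map_pow, map_mul, conj_ra_int ha, map_ofNat, map_ofNat,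
      map_ofNat]; ring
  have hxx : Ideal.span {(2 * a ^ 3 - 2 * a ^ 2 + 8 * a - 3 : 𝓞 KD)} * Ideal.span {(2 * a ^ 3 + 2 * a ^ 2 + 8 * a + 3 : 𝓞 KD)} =
      Ideal.span {((37 : ℕ) : 𝓞 KD)} := by
    rw [Ideal.span_singleton_mul_span_singleton, Nat.cast_ofNat,
      show ((2 * a ^ 3 - 2 * a ^ 2 + 8 * a - 3) * (2 * a ^ 3 + 2 * a ^ 2 + 8 * a + 3) : 𝓞 KD) = -37 by
        linear_combination (4 * a ^ 2 + 4 : 𝓞 KD) * ra_int_quartic hs ha,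
      Ideal.span_singleton_neg]
  have hNc : Ideal.absNorm (Ideal.span {(2 * a ^ 3 + 2 * a ^ 2 + 8 * a + 3 : 𝓞 KD)}) =
      Ideal.absNorm (Ideal.span {(2 * a ^ 3 - 2 * a ^ 2 + 8 * a - 3 : 𝓞 KD)}) := by
    rw [← absNorm_span_conj (2 * a ^ 3 - 2 * a ^ 2 + 8 * a - 3), hconj, Ideal.span_singleton_neg]
  have hNx : Ideal.absNorm (Ideal.span {(2 * a ^ 3 - 2 * a ^ 2 + 8 * a - 3 : 𝓞 KD)}) = 37 ^ 2 := by
    have h := congrArg Ideal.absNorm hxx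
    rw [map_mul, hNc, absNorm_span_natCast] at h
    have h' : Ideal.absNorm (Ideal.span {(2 * a ^ 3 - 2 * a ^ 2 + 8 * a - 3 : 𝓞 KD)}) ^ 2 = (37 ^ 2) ^ 2 := by
      rw [sq, h]; norm_num
    exact Nat.pow_left_injective two_ne_zero h'
  have hNx' : Ideal.absNorm (Ideal.span {(2 * a ^ 3 + 2 * a ^ 2 + 8 * a + 3 : 𝓞 KD)}) = 37 ^ 2 := by rw [hNc, hNx]
  have key : ∀ {I J : Ideal (𝓞 KD)}, I ≤ J → Ideal.absNorm I = Ideal.absNorm J → Ideal.absNorm J ≠ 0 → I = J := by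
    intro I J hle hIJ hJ
    exact (eq_and_eq_of_le_of_absNorm hle hle (by rw [hIJ]) hJ hJ).1
  have hA : Ideal.span {(2 * a ^ 3 - 2 * a ^ 2 + 8 * a - 3 : 𝓞 KD)} = Ideal.span {(37 : 𝓞 KD), a ^ 2 - 7 * a + 9} :=
    key (by rw [Ideal.span_singleton_le_iff_mem]; exact Ideal.mem_span_pair.mpr ⟨2 * a - 3, 2 * a + 12, by ring⟩)
      (by rw [hNx, h2.2]) (by rw [h2.2]; norm_num)
  have hB : Ideal.span {(2 * a ^ 3 + 2 * a ^ 2 + 8 * a + 3 : 𝓞 KD)} = Ideal.span {(37 : 𝓞 KD), a ^ 2 + 7 * a + 9} :=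
    key (by rw [Ideal.span_singleton_le_iff_mem]; exact Ideal.mem_span_pair.mpr ⟨2 * a + 3, 2 * a - 12, by ring⟩)
      (by rw [hNx', h1.2]) (by rw [h1.2]; norm_num)
  exact ⟨h, hA.symm, hB.symm, ⟨⟨_, hB.symm⟩⟩, ⟨⟨_, hA.symm⟩⟩⟩

/-- **`(4a³ + a² + 11a + 2) = 𝔓₂·(59, a² + 29a − 19)` and `(4a³ − a² + 11a − 2) = 𝔓₂·(59, a² − 29a − 19)`**, both elements of norm
`6962 = 2·59²` (`v ≡ −19`, `u ≡ 29`: `361 ≡ 7`, `841 ≡ 15 = 2v − 6`, `32` a non-residue mod `59`;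
`4a³ + a² + 11a + 2 = 59(58a − 37) + (a² + 29a − 19)(4a − 115) = 18 + (a − 1)(4a² + 5a + 16)`).
[cite: Marcus2018, Ch. 5, discussion after Thm 37] -/
theorem span_x59_eq (ha : (a : KD) = ra) :
    Ideal.span {(4 * a ^ 3 + a ^ 2 + 11 * a + 2 : 𝓞 KD)} = w₂.asIdeal * Ideal.span {(59 : 𝓞 KD), a ^ 2 + 29 * a - 19} ∧
      Ideal.span {(4 * a ^ 3 - a ^ 2 + 11 * a - 2 : 𝓞 KD)} = w₂.asIdeal * Ideal.span {(59 : 𝓞 KD), a ^ 2 - 29 * a - 19} ∧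
      Ideal.absNorm (Ideal.span {(4 * a ^ 3 + a ^ 2 + 11 * a + 2 : 𝓞 KD)}) = 6962 ∧
      Ideal.absNorm (Ideal.span {(4 * a ^ 3 - a ^ 2 + 11 * a - 2 : 𝓞 KD)}) = 6962 := by
  obtain ⟨-, h1, h2, -⟩ := span_natCast_eq_mul_two' ha (p := 59) (by norm_num) (by norm_num) (u := 29) (v := -19)
    (by decide) (by decide) (by decide)
  have e1 : (a ^ 2 + ((29 : ℤ) : 𝓞 KD) * a + ((-19 : ℤ) : 𝓞 KD)) = a ^ 2 + 29 * a - 19 := by push_cast; ring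
  have e2 : (a ^ 2 + -((29 : ℤ) : 𝓞 KD) * a + ((-19 : ℤ) : 𝓞 KD)) = a ^ 2 - 29 * a - 19 := by push_cast; ring
  rw [e1] at h1
  rw [e2] at h2
  simp only [Nat.cast_ofNat] at h1 h2
  obtain ⟨-, hN2⟩ := span_sq_add_three_eq hs w₂ ha
  have hs1 := span_sq_add_one_eq hs w₂ ha
  have hNw2 : Ideal.absNorm (w₂.asIdeal ^ 2) = 4 := by rw [map_pow, hN2]; norm_num
  have hconj : ringOfIntegersComplexConj KD (4 * a ^ 3 + a ^ 2 + 11 * a + 2) = -(4 * a ^ 3 - a ^ 2 + 11 * a - 2) := by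
    rw [map_add, map_add, map_add, map_mul, map_pow, map_pow, map_mul, conj_ra_int ha, map_ofNat, map_ofNat, map_ofNat]; ring
  have hxx : Ideal.span {(4 * a ^ 3 + a ^ 2 + 11 * a + 2 : 𝓞 KD)} * Ideal.span {(4 * a ^ 3 - a ^ 2 + 11 * a - 2 : 𝓞 KD)} =
      Ideal.span {((59 : ℕ) : 𝓞 KD)} * Ideal.span {(a ^ 2 + 1 : 𝓞 KD)} := by
    rw [Ideal.span_singleton_mul_span_singleton, Ideal.span_singleton_mul_span_singleton, Nat.cast_ofNat,
      show ((4 * a ^ 3 + a ^ 2 + 11 * a + 2) * (4 * a ^ 3 - a ^ 2 + 11 * a - 2) : 𝓞 KD) = 59 * (a ^ 2 + 1) by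
        linear_combination (16 * a ^ 2 - 9 : 𝓞 KD) * ra_int_quartic hs ha]
  have hNc : Ideal.absNorm (Ideal.span {(4 * a ^ 3 - a ^ 2 + 11 * a - 2 : 𝓞 KD)}) =
      Ideal.absNorm (Ideal.span {(4 * a ^ 3 + a ^ 2 + 11 * a + 2 : 𝓞 KD)}) := by
    rw [← absNorm_span_conj (4 * a ^ 3 + a ^ 2 + 11 * a + 2), hconj, Ideal.span_singleton_neg]
  have hNx : Ideal.absNorm (Ideal.span {(4 * a ^ 3 + a ^ 2 + 11 * a + 2 : 𝓞 KD)}) = 6962 := by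
    have h := congrArg Ideal.absNorm hxx
    rw [map_mul, map_mul, hNc, absNorm_span_natCast, hs1, hNw2] at h
    have h' : Ideal.absNorm (Ideal.span {(4 * a ^ 3 + a ^ 2 + 11 * a + 2 : 𝓞 KD)}) ^ 2 = 6962 ^ 2 := by rw [sq, h]; norm_num
    exact Nat.pow_left_injective two_ne_zero h'
  have hNx' : Ideal.absNorm (Ideal.span {(4 * a ^ 3 - a ^ 2 + 11 * a - 2 : 𝓞 KD)}) = 6962 := by rw [hNc, hNx]
  haveI := h1.1; haveI := h2.1
  have hw := w₂_eq_span_pair hs w₂ ha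
  refine ⟨?_, ?_, hNx, hNx'⟩
  · refine span_eq_w₂_mul_of_mem hs w₂ (by intro h0; rw [h0, Ideal.absNorm_bot] at h1; norm_num at h1)
      (by intro h0; rw [h0, hN2] at h1; norm_num at h1) (Ideal.mem_span_pair.mpr ⟨58 * a - 37, 4 * a - 115, by ring⟩) ?_
      (by norm_num [hNx, h1.2])
    rw [hw]; exact Ideal.mem_span_pair.mpr ⟨9, 4 * a ^ 2 + 5 * a + 16, by ring⟩
  · refine span_eq_w₂_mul_of_mem hs w₂ (by intro h0; rw [h0, Ideal.absNorm_bot] at h2; norm_num at h2)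
      (by intro h0; rw [h0, hN2] at h2; norm_num at h2) (Ideal.mem_span_pair.mpr ⟨58 * a + 37, 4 * a + 115, by ring⟩) ?_
      (by norm_num [hNx', h2.2])
    rw [hw]; exact Ideal.mem_span_pair.mpr ⟨6, 4 * a ^ 2 + 3 * a + 14, by ring⟩

omit h₂ in
/-- **`59𝓞_K = (59, a² + 29a − 19)(59, a² − 29a − 19)` and neither prime is principal** (both in `[𝔓₂]`).
[cite: Marcus2018, Ch. 3 Thm 27] [cite: Marcus2018, Ch. 5, discussion after Thm 37] -/
theorem not_isPrincipal_span_fiftyNine (ha : (a : KD) = ra) :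
    Ideal.span {(59 : 𝓞 KD)} = Ideal.span {(59 : 𝓞 KD), a ^ 2 + 29 * a - 19} * Ideal.span {(59 : 𝓞 KD), a ^ 2 - 29 * a - 19} ∧
      ¬ (Ideal.span {(59 : 𝓞 KD), a ^ 2 + 29 * a - 19}).IsPrincipal ∧ ¬ (Ideal.span {(59 : 𝓞 KD), a ^ 2 - 29 * a - 19}).IsPrincipal := by
  obtain ⟨h, -, -, -⟩ := span_natCast_eq_mul_two' ha (p := 59) (by norm_num) (by norm_num) (u := 29) (v := -19)
    (by decide) (by decide) (by decide)
  have e1 : (a ^ 2 + ((29 : ℤ) : 𝓞 KD) * a + ((-19 : ℤ) : 𝓞 KD)) = a ^ 2 + 29 * a - 19 := by push_cast; ring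
  have e2 : (a ^ 2 + -((29 : ℤ) : 𝓞 KD) * a + ((-19 : ℤ) : 𝓞 KD)) = a ^ 2 - 29 * a - 19 := by push_cast; ring
  rw [e1, e2] at h
  simp only [Nat.cast_ofNat] at h
  obtain ⟨w, hw, -⟩ := exists_prime_two' hs
  haveI := hw
  obtain ⟨hx1, hx2, -, -⟩ := span_x59_eq hs w ha
  have hP0 : ∀ t : 𝓞 KD, Ideal.span {(59 : 𝓞 KD), t} ≠ ⊥ := by
    intro t h0
    have h59 : (59 : 𝓞 KD) ∈ Ideal.span {(59 : 𝓞 KD), t} := Ideal.subset_span (by simp)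
    rw [h0, Ideal.mem_bot] at h59
    have h' := congrArg (fun z : 𝓞 KD => (z : KD)) h59
    push_cast at h'
    norm_num at h'
  have hz1 : (4 * a ^ 3 + a ^ 2 + 11 * a + 2 : 𝓞 KD) ≠ 0 := by
    intro h0
    rw [h0, Ideal.span_singleton_eq_bot.mpr rfl, eq_comm, Ideal.mul_eq_bot] at hx1
    exact hx1.elim w.ne_bot (hP0 _)
  have hz2 : (4 * a ^ 3 - a ^ 2 + 11 * a - 2 : 𝓞 KD) ≠ 0 := by
    intro h0
    rw [h0, Ideal.span_singleton_eq_bot.mpr rfl, eq_comm, Ideal.mul_eq_bot] at hx2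
    exact hx2.elim w.ne_bot (hP0 _)
  exact ⟨h, fun h' => not_isPrincipal_w₂ hs w ((isPrincipal_iff_of_mul_eq_span hx1.symm hz1).mpr h'),
    fun h' => not_isPrincipal_w₂ hs w ((isPrincipal_iff_of_mul_eq_span hx2.symm hz2).mpr h')⟩

end ClassesThirtySevenFiftyNine

/-! ### §6. `53` (degree two, principal) and `73` (shape `P₁P₂Q`, degree-one primes NOT principal)

`53 = (53, a² + 12a + 22)(53, a² − 12a + 22)` with `(a³ + 3a² + a + 12)(a³ − 3a² + a − 12) = −53`.  `73`: `r = 41`, `29² ≡ r − 3`,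
`−(r + 3)` a non-residue; `x = a² + a + 6` has `x x̄ = 5a² + 29 = (a² + 3)(7a² + 26)` with `7a² + 26 = 7(a² − 38) + 4·73`, and
`5a² + 1 = (a² + 3)(−7a² − 16)`, `−7a² − 16 = 4·73 − 7(a² + 44)`, `(5a² + 29)(5a² + 1) = 25(a⁴ + 6a² + 7) − 146`, so
`(5a² + 29) = 𝔓₂²(73, a − 29)(73, a + 29)`, `‖(x)‖ = 146` and `(x) = 𝔓₂·(73, a − 29)`. -/

section ClassesFiftyThreeSeventyThree

variable {s : 𝓞 (maximalRealSubfield KD)} (hs : ((s : maximalRealSubfield KD) : KD) = rs)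
variable {a : 𝓞 KD} (ha : (a : KD) = ra)
variable (w₂ : HeightOneSpectrum (𝓞 KD)) [h₂ : w₂.asIdeal.LiesOver (Ideal.span {s})]
include hs

omit h₂ in
/-- **`53𝓞_K = (53, a² + 12a + 22)(53, a² − 12a + 22)` with BOTH primes principal: `(53, a² − 12a + 22) = (a³ + 3a² + a + 12)`,
`(53, a² + 12a + 22) = (a³ − 3a² + a − 12)`** (`v ≡ 22`, `u ≡ 12`: `484 ≡ 7`, `144 ≡ 38 = 2v − 6`, `−50 ≡ 3` a non-residue mod `53`;
`(a³ + 3a² + a + 12)(a³ − 3a² + a − 12) = −53`; `a³ + 3a² + a + 12 = 53(3a − 6) + (a² − 12a + 22)(a + 15)`).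
[cite: Marcus2018, Ch. 3 Thm 27] [cite: Marcus2018, Ch. 5, discussion after Thm 37] -/
theorem span_fiftyThree_eq (ha : (a : KD) = ra) :
    Ideal.span {(53 : 𝓞 KD)} = Ideal.span {(53 : 𝓞 KD), a ^ 2 + 12 * a + 22} * Ideal.span {(53 : 𝓞 KD), a ^ 2 - 12 * a + 22} ∧
      Ideal.span {(53 : 𝓞 KD), a ^ 2 - 12 * a + 22} = Ideal.span {(a ^ 3 + 3 * a ^ 2 + a + 12 : 𝓞 KD)} ∧
      Ideal.span {(53 : 𝓞 KD), a ^ 2 + 12 * a + 22} = Ideal.span {(a ^ 3 - 3 * a ^ 2 + a - 12 : 𝓞 KD)} ∧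
      (Ideal.span {(53 : 𝓞 KD), a ^ 2 + 12 * a + 22}).IsPrincipal ∧ (Ideal.span {(53 : 𝓞 KD), a ^ 2 - 12 * a + 22}).IsPrincipal := by
  obtain ⟨h, h1, h2, -⟩ := span_natCast_eq_mul_two' ha (p := 53) (by norm_num) (by norm_num) (u := 12) (v := 22)
    (by decide) (by decide) (by decide)
  have e : (a ^ 2 + -((12 : ℤ) : 𝓞 KD) * a + ((22 : ℤ) : 𝓞 KD)) = a ^ 2 - 12 * a + 22 := by push_cast; ring
  rw [e] at h h2
  simp only [Nat.cast_ofNat, Int.cast_ofNat] at h h1 h2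
  have hconj : ringOfIntegersComplexConj KD (a ^ 3 + 3 * a ^ 2 + a + 12) = -(a ^ 3 - 3 * a ^ 2 + a - 12) := by
    rw [map_add, map_add, map_add, map_pow, map_mul, map_pow, conj_ra_int ha, map_ofNat, map_ofNat]; ring
  have hxx : Ideal.span {(a ^ 3 + 3 * a ^ 2 + a + 12 : 𝓞 KD)} * Ideal.span {(a ^ 3 - 3 * a ^ 2 + a - 12 : 𝓞 KD)} =
      Ideal.span {((53 : ℕ) : 𝓞 KD)} := by
    rw [Ideal.span_singleton_mul_span_singleton, Nat.cast_ofNat,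
      show ((a ^ 3 + 3 * a ^ 2 + a + 12) * (a ^ 3 - 3 * a ^ 2 + a - 12) : 𝓞 KD) = -53 by
        linear_combination (a ^ 2 - 13 : 𝓞 KD) * ra_int_quartic hs ha,
      Ideal.span_singleton_neg]
  have hNc : Ideal.absNorm (Ideal.span {(a ^ 3 - 3 * a ^ 2 + a - 12 : 𝓞 KD)}) =
      Ideal.absNorm (Ideal.span {(a ^ 3 + 3 * a ^ 2 + a + 12 : 𝓞 KD)}) := by
    rw [← absNorm_span_conj (a ^ 3 + 3 * a ^ 2 + a + 12), hconj, Ideal.span_singleton_neg]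
  have hNx : Ideal.absNorm (Ideal.span {(a ^ 3 + 3 * a ^ 2 + a + 12 : 𝓞 KD)}) = 53 ^ 2 := by
    have h := congrArg Ideal.absNorm hxx
    rw [map_mul, hNc, absNorm_span_natCast] at h
    have h' : Ideal.absNorm (Ideal.span {(a ^ 3 + 3 * a ^ 2 + a + 12 : 𝓞 KD)}) ^ 2 = (53 ^ 2) ^ 2 := by rw [sq, h]; norm_num
    exact Nat.pow_left_injective two_ne_zero h'
  have hNx' : Ideal.absNorm (Ideal.span {(a ^ 3 - 3 * a ^ 2 + a - 12 : 𝓞 KD)}) = 53 ^ 2 := by rw [hNc, hNx]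
  have key : ∀ {I J : Ideal (𝓞 KD)}, I ≤ J → Ideal.absNorm I = Ideal.absNorm J → Ideal.absNorm J ≠ 0 → I = J := by
    intro I J hle hIJ hJ
    exact (eq_and_eq_of_le_of_absNorm hle hle (by rw [hIJ]) hJ hJ).1
  have hA : Ideal.span {(a ^ 3 + 3 * a ^ 2 + a + 12 : 𝓞 KD)} = Ideal.span {(53 : 𝓞 KD), a ^ 2 - 12 * a + 22} :=
    key (by rw [Ideal.span_singleton_le_iff_mem]; exact Ideal.mem_span_pair.mpr ⟨3 * a - 6, a + 15, by ring⟩)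
      (by rw [hNx, h2.2]) (by rw [h2.2]; norm_num)
  have hB : Ideal.span {(a ^ 3 - 3 * a ^ 2 + a - 12 : 𝓞 KD)} = Ideal.span {(53 : 𝓞 KD), a ^ 2 + 12 * a + 22} :=
    key (by rw [Ideal.span_singleton_le_iff_mem]; exact Ideal.mem_span_pair.mpr ⟨3 * a + 6, a - 15, by ring⟩)
      (by rw [hNx', h1.2]) (by rw [h1.2]; norm_num)
  exact ⟨h, hA.symm, hB.symm, ⟨⟨_, hB.symm⟩⟩, ⟨⟨_, hA.symm⟩⟩⟩

/-- **`73𝓞_K = (73, a − 29)(73, a + 29)(73, a² + 44)` with `(5a² + 29) = 𝔓₂²·(73, a − 29)(73, a + 29)`,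
`(5a² + 1) = 𝔓₂²·(73, a² + 44)` and `(a² + a + 6) = 𝔓₂·(73, a − 29)`** (`‖(a² + a + 6)‖ = 146`;
`a² + a + 6 = 12·73 + (a − 29)(a + 30) = 8 + (a − 1)(a + 2)`). [cite: Marcus2018, Ch. 3 Thm 27]
[cite: Marcus2018, Ch. 5, discussion after Thm 37] -/
theorem span_seventyThree_factors (ha : (a : KD) = ra) :
    Ideal.span {(73 : 𝓞 KD)} =
      Ideal.span {(73 : 𝓞 KD), a - 29} * Ideal.span {(73 : 𝓞 KD), a + 29} * Ideal.span {(73 : 𝓞 KD), a ^ 2 + 44} ∧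
      Ideal.span {(5 * a ^ 2 + 29 : 𝓞 KD)} = w₂.asIdeal ^ 2 * (Ideal.span {(73 : 𝓞 KD), a - 29} * Ideal.span {(73 : 𝓞 KD), a + 29}) ∧
      Ideal.span {(5 * a ^ 2 + 1 : 𝓞 KD)} = w₂.asIdeal ^ 2 * Ideal.span {(73 : 𝓞 KD), a ^ 2 + 44} ∧
      Ideal.span {(a ^ 2 + a + 6 : 𝓞 KD)} = w₂.asIdeal * Ideal.span {(73 : 𝓞 KD), a - 29} ∧
      Ideal.absNorm (Ideal.span {(a ^ 2 + a + 6 : 𝓞 KD)}) = 146 := by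
  obtain ⟨h, h1, h2, h3⟩ := span_natCast_eq_mul_three ha (p := 73) (by norm_num) (r := 41) (c := 29)
    (by decide) (by decide) (by decide)
  obtain ⟨hPP, -⟩ := span_sub_mul_span_add_eq_three ha (p := 73) (by norm_num) (r := 41) (c := 29)
    (by decide) (by decide) (by decide)
  obtain ⟨hs3, hN2⟩ := span_sq_add_three_eq hs w₂ ha
  have e1 : (a ^ 2 + 3 + ((41 : ℤ) : 𝓞 KD)) = a ^ 2 + 44 := by push_cast; ring
  have e2 : (a ^ 2 + 3 - ((41 : ℤ) : 𝓞 KD)) = a ^ 2 - 38 := by push_cast; ring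
  rw [e1] at h h3
  rw [e2] at hPP
  simp only [Nat.cast_ofNat, Int.cast_ofNat] at h h1 h2 h3 hPP
  have hNPP : Ideal.absNorm (Ideal.span {(73 : 𝓞 KD), a - 29} * Ideal.span {(73 : 𝓞 KD), a + 29}) = 73 ^ 2 := by
    rw [map_mul, h1.2, h2.2]; ring
  have hNw2 : Ideal.absNorm (w₂.asIdeal ^ 2) = 4 := by rw [map_pow, hN2]; norm_num
  have f1 : (5 * a ^ 2 + 29 : 𝓞 KD) = (a ^ 2 + 3) * (7 * a ^ 2 + 26) := by
    linear_combination (-7 : 𝓞 KD) * ra_int_quartic hs ha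
  have f2 : (5 * a ^ 2 + 1 : 𝓞 KD) = (a ^ 2 + 3) * (-7 * a ^ 2 - 16) := by
    linear_combination (7 : 𝓞 KD) * ra_int_quartic hs ha
  have hY : Ideal.span {(5 * a ^ 2 + 29 : 𝓞 KD)} ≤ w₂.asIdeal ^ 2 * (Ideal.span {(73 : 𝓞 KD), a - 29} * Ideal.span {(73 : 𝓞 KD), a + 29}) := by
    rw [← hs3, hPP, Ideal.span_singleton_le_iff_mem]
    have hmem : (a ^ 2 + 3) * (7 * a ^ 2 + 26) ∈ Ideal.span {(a ^ 2 + 3 : 𝓞 KD)} * Ideal.span {(73 : 𝓞 KD), a ^ 2 - 38} :=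
      Ideal.mul_mem_mul (Ideal.mem_span_singleton_self _) (Ideal.mem_span_pair.mpr ⟨4, 7, by ring⟩)
    rwa [← f1] at hmem
  have hZ : Ideal.span {(5 * a ^ 2 + 1 : 𝓞 KD)} ≤ w₂.asIdeal ^ 2 * Ideal.span {(73 : 𝓞 KD), a ^ 2 + 44} := by
    rw [← hs3, Ideal.span_singleton_le_iff_mem]
    have hmem : (a ^ 2 + 3) * (-7 * a ^ 2 - 16) ∈ Ideal.span {(a ^ 2 + 3 : 𝓞 KD)} * Ideal.span {(73 : 𝓞 KD), a ^ 2 + 44} :=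
      Ideal.mul_mem_mul (Ideal.mem_span_singleton_self _) (Ideal.mem_span_pair.mpr ⟨4, -7, by ring⟩)
    rwa [← f2] at hmem
  have hprod : Ideal.span {(5 * a ^ 2 + 29 : 𝓞 KD)} * Ideal.span {(5 * a ^ 2 + 1 : 𝓞 KD)} = Ideal.span {((146 : ℕ) : 𝓞 KD)} := by
    rw [Ideal.span_singleton_mul_span_singleton, Nat.cast_ofNat,
      show ((5 * a ^ 2 + 29) * (5 * a ^ 2 + 1) : 𝓞 KD) = -146 by linear_combination (25 : 𝓞 KD) * ra_int_quartic hs ha,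
      Ideal.span_singleton_neg]
  have hNA : Ideal.absNorm (w₂.asIdeal ^ 2 * (Ideal.span {(73 : 𝓞 KD), a - 29} * Ideal.span {(73 : 𝓞 KD), a + 29})) =
      4 * 73 ^ 2 := by
    rw [map_mul, hNw2, hNPP]
  have hNB : Ideal.absNorm (w₂.asIdeal ^ 2 * Ideal.span {(73 : 𝓞 KD), a ^ 2 + 44}) = 4 * 73 ^ 2 := by
    rw [map_mul, hNw2, h3.2]
  have hN : Ideal.absNorm (Ideal.span {(5 * a ^ 2 + 29 : 𝓞 KD)}) * Ideal.absNorm (Ideal.span {(5 * a ^ 2 + 1 : 𝓞 KD)}) =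
      Ideal.absNorm (w₂.asIdeal ^ 2 * (Ideal.span {(73 : 𝓞 KD), a - 29} * Ideal.span {(73 : 𝓞 KD), a + 29})) *
        Ideal.absNorm (w₂.asIdeal ^ 2 * Ideal.span {(73 : 𝓞 KD), a ^ 2 + 44}) := by
    rw [← map_mul, hprod, absNorm_span_natCast, hNA, hNB]; norm_num
  obtain ⟨hA, hB⟩ := eq_and_eq_of_le_of_absNorm hY hZ hN (by rw [hNA]; norm_num) (by rw [hNB]; norm_num)
  have hconj : ringOfIntegersComplexConj KD (a ^ 2 + a + 6) = a ^ 2 - a + 6 := by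
    rw [map_add, map_add, map_pow, conj_ra_int ha, map_ofNat]; ring
  have hxx : Ideal.span {(a ^ 2 + a + 6 : 𝓞 KD)} * Ideal.span {(a ^ 2 - a + 6 : 𝓞 KD)} = Ideal.span {(5 * a ^ 2 + 29 : 𝓞 KD)} := by
    rw [Ideal.span_singleton_mul_span_singleton,
      show ((a ^ 2 + a + 6) * (a ^ 2 - a + 6) : 𝓞 KD) = 5 * a ^ 2 + 29 by linear_combination ra_int_quartic hs ha]
  have hNx : Ideal.absNorm (Ideal.span {(a ^ 2 + a + 6 : 𝓞 KD)}) = 146 := by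
    have h := congrArg Ideal.absNorm hxx
    rw [map_mul, ← hconj, absNorm_span_conj, hA, hNA] at h
    have h' : Ideal.absNorm (Ideal.span {(a ^ 2 + a + 6 : 𝓞 KD)}) ^ 2 = 146 ^ 2 := by rw [sq, h]; norm_num
    exact Nat.pow_left_injective two_ne_zero h'
  haveI := h1.1
  refine ⟨h, hA, hB, ?_, hNx⟩
  refine span_eq_w₂_mul_of_mem hs w₂ (by intro h0; rw [h0, Ideal.absNorm_bot] at h1; norm_num at h1)
    (by intro h0; rw [h0, hN2] at h1; norm_num at h1) (Ideal.mem_span_pair.mpr ⟨12, a + 30, by ring⟩) ?_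
    (by norm_num [hNx, h1.2])
  rw [w₂_eq_span_pair hs w₂ ha]; exact Ideal.mem_span_pair.mpr ⟨4, a + 2, by ring⟩

omit h₂ in
/-- **`(73, a − 29)` and `(73, a + 29)` are NOT principal** (class `[𝔓₂]`; the degree-two prime `(73, a² + 44)` is principal by
`NonGaloisQuarticCMFieldClassNumber.isPrincipal_span_pair_sq`). [cite: Marcus2018, Ch. 5, discussion after Thm 37] -/
theorem not_isPrincipal_span_seventyThree (ha : (a : KD) = ra) :
    ¬ (Ideal.span {(73 : 𝓞 KD), a - 29}).IsPrincipal ∧ ¬ (Ideal.span {(73 : 𝓞 KD), a + 29}).IsPrincipal := by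
  obtain ⟨w, hw, -⟩ := exists_prime_two' hs
  haveI := hw
  obtain ⟨-, -, -, hx, hNx⟩ := span_seventyThree_factors hs w ha
  have hz : (a ^ 2 + a + 6 : 𝓞 KD) ≠ 0 := by
    intro h0; rw [h0, Ideal.span_singleton_eq_bot.mpr rfl, Ideal.absNorm_bot] at hNx; norm_num at hNx
  have n29 : ¬ (Ideal.span {(73 : 𝓞 KD), a - 29}).IsPrincipal :=
    fun h => not_isPrincipal_w₂ hs w ((isPrincipal_iff_of_mul_eq_span hx.symm hz).mpr h)
  have hiff := isPrincipal_span_pair_sub_iff_three hs ha (p := 73) (by norm_num) (r := 41) (c := 29)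
    (by decide) (by decide) (by decide)
  simp only [Nat.cast_ofNat, Int.cast_ofNat] at hiff
  exact ⟨n29, fun h => n29 (hiff.mpr h)⟩

end ClassesFiftyThreeSeventyThree

end NonGaloisQuarticCM

end Literature.NumberTheory.NumberFields
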